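import Summits.CriticalPhenomena.Ising3DConformalLimit.Theses.EnergyNotSigmaSquared
import Summits.CriticalPhenomena.Ising3DConformalLimit.Theorems.EnergyNotSigmaSquaredRungOneAdjacentMergingChebyshev
import Summits.CriticalPhenomena.Ising3DConformalLimit.Theorems.EnergyNotSigmaSquaredRungOneAdjacentMergingBoxPassage
import Summits.CriticalPhenomena.Ising3DConformalLimit.Theorems.EnergyNotSigmaSquaredRungOneAdjacentMergingCells
import Summits.CriticalPhenomena.Ising3DConformalLimit.Theorems.EnergyNotSigmaSquaredRungOneAdjacentMergingWindowRegular
import Summits.CriticalPhenomena.Ising3DConformalLimit.Theorems.EnergyNotSigmaSquaredRungOneAdjacentMergingHarvestInputs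
import Summits.CriticalPhenomena.Ising3DConformalLimit.Theorems.EnergyNotSigmaSquaredRungOneAdjacentMergingAssemblyAux

/-!
# CANDIDATE PROOF OF THE CRUX `RungOneAdjacentMerging` (item stmt-CriticalPhenomena-11262) — drefute gen 3

ONE self-contained file, importing ONLY landed tree modules (the route file, the five landed stub
theorems of line `dominant-shell-concentration` — Chebyshev p73269, BoxPassage p72997, Cells p72844,
WindowRegular p72861, HarvestInputs p73276 — and the lead's AssemblyAux p73984), that proves the route
declaration `Summit.CriticalPhenomena.Ising3DConformalLimit.Theses.EnergyNotSigmaSquared.RungOneAdjacentMerging`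
WITHOUT `sorry`: part 1 = drefute gen 2's proof of `AbstractHarvest` (crux workfile `HarvestCoreG2.lean`,
verbatim), part 2 = drefute gen 3's proof of `Assembly` (`AssemblyG3.lean`, verbatim), part 3 = the
skeleton's composition (`shareHarvest_of`, `rungOne_of_varianceBound`) re-done against the landed stubs.
Refuters do not land positive statements: this is candidate evidence for the lead prover
(`prover-line-stmt-CriticalPhenomena-11262-0`), who lands parts 1 and 2 as the registered stubs
`stub_abstractHarvest` / `stub_assembly` and then the crux through `RungOneAdjacentMerging_of`.
-/

/-! ## Part 1 — `AbstractHarvest` (drefute gen 2, HarvestCoreG2.lean verbatim minus its import) -/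

/-!
# `AbstractHarvest` — complete proof (drefute gen 2, refuter-drefute-stmt-CriticalPhenomena-11262-g2-0)

Sorry-free proof of `AbstractHarvest` (= registered stub `stub_abstractHarvest` of line
`dominant-shell-concentration`, crux `RungOneAdjacentMerging`, item stmt-CriticalPhenomena-11262),
following `DREFUTE-g2-AbstractHarvest.md`.  `lean check`: rc 0, 0 sorry, 0 warnings; axioms of
`HarvestCore.abstractHarvest_proof` = {propext, Classical.choice, Quot.sound}.
Notation: `sh a B k = 8^k a(k+2)²/B(k+1)` (the abstract share).  Contents (namespace `HarvestCore`):
* basics: `B_pos'`, `sh_nonneg`, `sh_pos`, F1 `sh_le` (`≤ 1/7`), F2 `B_add_three_le`, `B_le_exp_sum`,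
  (i) `sh_sum_unbounded`, `sh_le_of_num_le`, `chain_le`, F4 `ancestor` (`D ≥ 32`, factor `8/D`),
  F3 `sh_succ_identity`, `sh_succ_le`, `decay_sep_of_blocks`, `exists_residue_class` (pigeonhole),
  `index_sep_of_residue`, `exists_residue_modulus`;
* blocks: `exists_next`, `nextStart`, `blk` (greedy τ-chain) with `blk_lt_succ/sep/flat/ge/strictMono/
  add_ge`, `exists_blk_index`, `sep_of_blk`; `chain` (iterated ancestor); `four_mul_sh_le`,
  `pow_four_mul_sh_le` (F3 lower form iterated); (iii) `core_le`, `geom_core_le`, `block_sum_le`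
  (constant `4/(3τ²) + 4680`);
* endgame: `harvest_of_decayFamily` (residue pigeonhole over `min τ 1`);
  Case A `caseA_family`, `caseA`; Case B `sum_blocks`, `geom_half_le`, `caseB` (unsaturated blocks,
  ancestor transfer with weights `(1/2)^{i-j}`, per-block representatives, parity classes);
* `abstractHarvest_proof : AbstractHarvest` (A = 128^16 = 2^112) and the verbatim-signature corollary
  `stub_abstractHarvest_candidate`.
The landing (as `theorem stub_abstractHarvest`) is the lead prover's; a 4-file split (≤ 400 lines each,
namespace `AbstractHarvestProof` to avoid FQN clashes with this workfile) is attached as evidence.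
-/

noncomputable section

open Finset Filter
open scoped BigOperators

namespace Summit.CriticalPhenomena.Ising3DConformalLimit.RungOneAdjacentMergingDominantShell
namespace HarvestCore

variable {a B : ℕ → ℝ}

/-- The abstract share of scale `k`: `8^k a(k+2)² / B(k+1)`. -/
def sh (a B : ℕ → ℝ) (k : ℕ) : ℝ := 8 ^ k * a (k + 2) ^ 2 / B (k + 1)

/-- `B k > 0` (monotone from `B 0 > 0`). -/
theorem B_pos' (h : HarvestData a B) (k : ℕ) : 0 < B k :=
  h.B_pos.trans_le (h.B_mono (Nat.zero_le k))

/-- Shares are nonnegative. -/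
theorem sh_nonneg (h : HarvestData a B) (k : ℕ) : 0 ≤ sh a B k :=
  div_nonneg (mul_nonneg (pow_nonneg (by norm_num) _) (sq_nonneg _)) (B_pos' h _).le

/-- Shares are positive. -/
theorem sh_pos (h : HarvestData a B) (k : ℕ) : 0 < sh a B k :=
  div_pos (mul_pos (pow_pos (by norm_num) _) (pow_pos (h.a_pos _) 2)) (B_pos' h _)

/-- F1: `sh k ≤ 1/7` for `k ≥ 1` (`B(k+1) ≥ B k ≥ B k - B(k-1) ≥ 7·8^k a(k+2)²`). -/
theorem sh_le (h : HarvestData a B) {k : ℕ} (hk : 1 ≤ k) : sh a B k ≤ 1 / 7 := by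
  have hB1 : 0 < B (k + 1) := B_pos' h _
  have hlow := h.shell_lower k hk
  have hBk1 : 0 < B (k - 1) := B_pos' h _
  have hmono : B k ≤ B (k + 1) := h.B_mono (Nat.le_succ k)
  unfold sh
  rw [div_le_iff₀ hB1]
  nlinarith

/-- F2: `B(j+3) ≤ (1 + 9728·sh j)·B(j+2)` (shell_upper at `j+3`: `B(j+3) - B(j+2) ≤ 19·8^{j+3} a(j+2)²
= 9728·sh j·B(j+1) ≤ 9728·sh j·B(j+2)`). -/
theorem B_add_three_le (h : HarvestData a B) (j : ℕ) :
    B (j + 3) ≤ (1 + 9728 * sh a B j) * B (j + 2) := by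
  have hup := h.shell_upper (j + 3) (by omega)
  have hB1 : 0 < B (j + 1) := B_pos' h _
  have hmono : B (j + 1) ≤ B (j + 2) := h.B_mono (by omega)
  have hsh : sh a B j * B (j + 1) = 8 ^ j * a (j + 2) ^ 2 := by
    unfold sh; field_simp
  have h1 : B (j + 3) - B (j + 2) ≤ 9728 * sh a B j * B (j + 1) := by
    have : (19 : ℝ) * 8 ^ (j + 3) * a (j + 3 - 1) ^ 2 = 9728 * (8 ^ j * a (j + 2) ^ 2) := by
      rw [show j + 3 - 1 = j + 2 from rfl, pow_add]; ring
    rw [show j + 3 - 1 = j + 2 from rfl] at hup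
    calc B (j + 3) - B (j + 2) = B (j + 3) - B (j + 3 - 1) := by rw [show j + 3 - 1 = j + 2 from rfl]
      _ ≤ 19 * 8 ^ (j + 3) * a (j + 2) ^ 2 := hup
      _ = 9728 * (sh a B j * B (j + 1)) := by rw [hsh, pow_add]; ring
      _ = 9728 * sh a B j * B (j + 1) := by ring
  have hshnn : 0 ≤ sh a B j := sh_nonneg h j
  nlinarith [mul_le_mul_of_nonneg_left hmono (by positivity : (0:ℝ) ≤ 9728 * sh a B j)]

/-- Iterating F2: `B(N+2) ≤ exp(9728·Σ_{j<N} sh j)·B 2`. -/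
theorem B_le_exp_sum (h : HarvestData a B) (N : ℕ) :
    B (N + 2) ≤ Real.exp (9728 * ∑ j ∈ range N, sh a B j) * B 2 := by
  induction N with
  | zero => simp
  | succ n ih =>
    have hB2 : 0 < B 2 := B_pos' h 2
    have hstep := B_add_three_le h n
    have hfac : 1 + 9728 * sh a B n ≤ Real.exp (9728 * sh a B n) := by
      have := Real.add_one_le_exp (9728 * sh a B n); linarith
    have hBn2 : 0 ≤ B (n + 2) := (B_pos' h _).le
    calc B (n + 1 + 2) = B (n + 3) := by rw [show n + 1 + 2 = n + 3 by omega]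
      _ ≤ (1 + 9728 * sh a B n) * B (n + 2) := hstep
      _ ≤ Real.exp (9728 * sh a B n) * (Real.exp (9728 * ∑ j ∈ range n, sh a B j) * B 2) :=
          mul_le_mul hfac ih hBn2 (Real.exp_pos _).le
      _ = Real.exp (9728 * ∑ j ∈ range (n + 1), sh a B j) * B 2 := by
          rw [sum_range_succ, mul_add, Real.exp_add]; ring

/-- (i): the shares are not summable — every level `S` is exceeded by a finite prefix sum
(F2 iterated bounds `B` by `exp(9728 Σ sh)·B 2`, contradicting `B → ∞`). -/
theorem sh_sum_unbounded (h : HarvestData a B) (S : ℝ) :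
    ∃ N : ℕ, S ≤ ∑ k ∈ range N, sh a B k := by
  by_contra hcon
  push Not at hcon
  have hB2 : 0 < B 2 := B_pos' h 2
  -- B is bounded by exp(9728 S) * B 2 along n+2
  have hbound : ∀ N, B (N + 2) ≤ Real.exp (9728 * S) * B 2 := fun N =>
    (B_le_exp_sum h N).trans (mul_le_mul_of_nonneg_right
      (Real.exp_le_exp.mpr (by nlinarith [hcon N])) hB2.le)
  -- contradiction with B → ∞
  have hev := (h.B_tendsto.eventually (eventually_gt_atTop (Real.exp (9728 * S) * B 2)))
  rw [eventually_atTop] at hev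
  obtain ⟨N₀, hN₀⟩ := hev
  have := hN₀ (N₀ + 2) (by omega)
  exact absurd (hbound N₀) (not_le.mpr this)

/-- Comparison of two shares through their numerators (`B` is monotone). -/
theorem sh_le_of_num_le (h : HarvestData a B) {k k' : ℕ} (hk : k' ≤ k) {c : ℝ} (hc : 0 ≤ c)
    (hnum : 8 ^ k * a (k + 2) ^ 2 ≤ c * (8 ^ k' * a (k' + 2) ^ 2)) :
    sh a B k ≤ c * sh a B k' := by
  have hB : 0 < B (k + 1) := B_pos' h _
  have hB' : 0 < B (k' + 1) := B_pos' h _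
  have hmono : B (k' + 1) ≤ B (k + 1) := h.B_mono (by omega)
  have hnum' : 0 ≤ 8 ^ k' * a (k' + 2) ^ 2 := by positivity
  unfold sh
  rw [div_le_iff₀ hB, mul_div_assoc', div_mul_eq_mul_div, le_div_iff₀ hB']
  calc 8 ^ k * a (k + 2) ^ 2 * B (k' + 1) ≤ c * (8 ^ k' * a (k' + 2) ^ 2) * B (k' + 1) :=
        mul_le_mul_of_nonneg_right hnum hB'.le
    _ ≤ c * (8 ^ k' * a (k' + 2) ^ 2) * B (k + 1) :=
        mul_le_mul_of_nonneg_left hmono (mul_nonneg hc hnum')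

/-- Chain of one-step ratio bounds: if `a (s+i) ≤ D²·a (s+i+1)` for `i < m` then
`a s ≤ D^(2m)·a (s+m)`. -/
theorem chain_le {D : ℝ} (hD : 0 ≤ D) (s : ℕ) :
    ∀ m : ℕ, (∀ i, i < m → a (s + i) ≤ D ^ 2 * a (s + i + 1)) → a s ≤ D ^ (2 * m) * a (s + m) := by
  intro m
  induction m with
  | zero => intro _; simp
  | succ m ih =>
    intro hyp
    have h1 : a s ≤ D ^ (2 * m) * a (s + m) := ih fun i hi => hyp i (by omega)
    have h2 : a (s + m) ≤ D ^ 2 * a (s + m + 1) := hyp m (by omega)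
    calc a s ≤ D ^ (2 * m) * a (s + m) := h1
      _ ≤ D ^ (2 * m) * (D ^ 2 * a (s + m + 1)) := mul_le_mul_of_nonneg_left h2 (by positivity)
      _ = D ^ (2 * (m + 1)) * a (s + (m + 1)) := by
          rw [show 2 * (m + 1) = 2 * m + 2 by ring, pow_add, show s + (m + 1) = s + m + 1 by ring]
          ring

/-- F4, the ANCESTOR LEMMA: if `k ≥ 6` is not `D^16`-windowed (`D ≥ 32`), some `k' ∈ [k-6, k-1]`
has `sh k ≤ (8/D)·sh k'`.  (Some one-step ratio `a j/a(j+1)`, `j ∈ [k-4,k+3]`, exceeds `D²`;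
`j ≤ k+1`: parent `j-2`, factor `8^6/D^4 ≤ 8/D`; `j = k+2` resp. `k+3`: dyadic log-convexity
transports the drop to `a(k+1)/a(k+2) > D` resp. `> √D`, parent `k-1`, factor `8/D²` resp. `8/D`.) -/
theorem ancestor (h : HarvestData a B) {D : ℝ} (hD : 32 ≤ D) {k : ℕ} (hk : 6 ≤ k)
    (hnw : D ^ 16 * a (k + 4) < a (k - 4)) :
    ∃ k', k - 6 ≤ k' ∧ k' < k ∧ sh a B k ≤ 8 / D * sh a B k' := by
  obtain ⟨n, rfl⟩ : ∃ n, k = n + 6 := ⟨k - 6, by omega⟩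
  have hD0 : (0 : ℝ) ≤ D := by linarith
  have hD1 : (1 : ℝ) ≤ D := by linarith
  have hk4 : n + 6 - 4 = n + 2 := by omega
  rw [hk4] at hnw
  -- some one-step ratio exceeds D²
  have hex : ∃ i, i < 8 ∧ D ^ 2 * a (n + 2 + i + 1) < a (n + 2 + i) := by
    by_contra hno
    push Not at hno
    have := chain_le (a := a) hD0 (n + 2) 8 fun i hi => hno i hi
    rw [show n + 2 + 8 = n + 6 + 4 by ring, show 2 * 8 = 16 by rfl] at this
    linarith
  obtain ⟨i, hi8, hdrop⟩ := hex
  have apos : ∀ j, 0 < a j := h.a_pos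
  -- the three cases
  by_cases hi5 : i ≤ 5
  · -- parent n + i (= j - 2 with j = n+2+i ≤ k+1)
    refine ⟨n + i, by omega, by omega, ?_⟩
    have hc : (0 : ℝ) ≤ 8 ^ 6 / D ^ 4 := by positivity
    have hcle : (8 : ℝ) ^ 6 / D ^ 4 ≤ 8 / D := by
      rw [div_le_div_iff₀ (by positivity) (by positivity)]
      have : (32 : ℝ) ^ 3 ≤ D ^ 3 := by gcongr
      nlinarith
    have key : sh a B (n + 6) ≤ 8 ^ 6 / D ^ 4 * sh a B (n + i) := by
      apply sh_le_of_num_le h (by omega) hc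
      -- 8^(n+6) a(n+8)² ≤ (8^6/D^4)·(8^(n+i) a(n+i+2)²)
      have ha1 : a (n + 6 + 2) ≤ a (n + 2 + i + 1) := h.a_anti (by omega)
      have ha2 : D ^ 2 * a (n + 2 + i + 1) < a (n + 2 + i) := hdrop
      have hsq : D ^ 4 * a (n + 6 + 2) ^ 2 ≤ a (n + i + 2) ^ 2 := by
        have hle : D ^ 2 * a (n + 6 + 2) ≤ a (n + i + 2) := by
          rw [show n + i + 2 = n + 2 + i by ring]
          exact (mul_le_mul_of_nonneg_left ha1 (by positivity)).trans ha2.le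
        have hnn : 0 ≤ D ^ 2 * a (n + 6 + 2) := mul_nonneg (by positivity) (apos _).le
        nlinarith [mul_self_le_mul_self hnn hle]
      have hpow : (8 : ℝ) ^ (n + 6) ≤ 8 ^ 6 * 8 ^ (n + i) := by
        rw [← pow_add]; exact pow_le_pow_right₀ (by norm_num) (by omega)
      have hD4 : (0 : ℝ) < D ^ 4 := by positivity
      calc (8 : ℝ) ^ (n + 6) * a (n + 6 + 2) ^ 2
          ≤ (8 ^ 6 * 8 ^ (n + i)) * (a (n + i + 2) ^ 2 / D ^ 4) := by
            apply mul_le_mul hpow _ (sq_nonneg _) (by positivity)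
            rw [le_div_iff₀ hD4]; linarith
        _ = 8 ^ 6 / D ^ 4 * (8 ^ (n + i) * a (n + i + 2) ^ 2) := by ring
    exact key.trans (mul_le_mul_of_nonneg_right hcle (sh_nonneg h _))
  · -- i = 6 or i = 7: parent n + 5 = k - 1
    refine ⟨n + 5, by omega, by omega, ?_⟩
    have hc : (0 : ℝ) ≤ 8 / D := by positivity
    apply sh_le_of_num_le h (by omega) hc
    -- need: 8^(n+6) a(n+8)² ≤ (8/D)·(8^(n+5) a(n+7)²), i.e. D·a(n+8)² ≤ a(n+7)²
    have hmain : D * a (n + 8) ^ 2 ≤ a (n + 7) ^ 2 := by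
      rcases (show i = 6 ∨ i = 7 by omega) with rfl | rfl
      · -- drop at j = n+8: D² a(n+9) < a(n+8)
        have hd : D ^ 2 * a (n + 9) < a (n + 8) := by
          simpa [show n + 2 + 6 + 1 = n + 9 by ring, show n + 2 + 6 = n + 8 by ring] using hdrop
        have hlc := h.a_logConvex (n + 7)   -- a(n+8)^3 ≤ a(n+7)^2 a(n+9)
        rw [show n + 7 + 1 = n + 8 by ring, show n + 7 + 2 = n + 9 by ring] at hlc
        have h8 := apos (n + 8)
        have h9 := apos (n + 9)
        -- D² a(n+8)³ ≤ D² a(n+7)² a(n+9) < a(n+7)² a(n+8)  ⇒ D² a(n+8)² < a(n+7)²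
        have : D ^ 2 * a (n + 8) ^ 2 ≤ a (n + 7) ^ 2 := by
          by_contra hcon
          push Not at hcon
          nlinarith [mul_lt_mul_of_pos_left hd (pow_pos (apos (n+7)) 2), mul_le_mul_of_nonneg_left hlc (sq_nonneg D)]
        nlinarith [sq_nonneg (a (n + 8))]
      · -- drop at j = n+9: D² a(n+10) < a(n+9)
        have hd : D ^ 2 * a (n + 10) < a (n + 9) := by
          simpa [show n + 2 + 7 + 1 = n + 10 by ring, show n + 2 + 7 = n + 9 by ring] using hdrop
        have hlc8 := h.a_logConvex (n + 8)   -- a(n+9)^3 ≤ a(n+8)^2 a(n+10)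
        have hlc7 := h.a_logConvex (n + 7)   -- a(n+8)^3 ≤ a(n+7)^2 a(n+9)
        rw [show n + 8 + 1 = n + 9 by ring, show n + 8 + 2 = n + 10 by ring] at hlc8
        rw [show n + 7 + 1 = n + 8 by ring, show n + 7 + 2 = n + 9 by ring] at hlc7
        have h8 := apos (n + 8); have h9 := apos (n + 9); have h10 := apos (n + 10)
        -- step 1: D² a(n+9)² < a(n+8)², hence D a(n+9) < a(n+8)
        have s1 : D ^ 2 * a (n + 9) ^ 2 ≤ a (n + 8) ^ 2 := by
          by_contra hcon
          push Not at hcon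
          nlinarith [mul_lt_mul_of_pos_left hd (pow_pos h8 2), mul_le_mul_of_nonneg_left hlc8 (sq_nonneg D)]
        have s1' : D * a (n + 9) ≤ a (n + 8) := by
          by_contra hcon
          push Not at hcon
          have hp1 : 0 < D * a (n + 9) - a (n + 8) := sub_pos.2 hcon
          have hp2 : 0 < D * a (n + 9) + a (n + 8) := by nlinarith [mul_nonneg hD0 h9.le]
          nlinarith [mul_pos hp1 hp2]
        -- step 2: a(n+8)^3 ≤ a(n+7)^2 a(n+9) ≤ a(n+7)^2 a(n+8)/D
        have : D * a (n + 8) ^ 3 ≤ a (n + 7) ^ 2 * a (n + 8) := by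
          calc D * a (n + 8) ^ 3 ≤ D * (a (n + 7) ^ 2 * a (n + 9)) := mul_le_mul_of_nonneg_left hlc7 hD0
            _ = a (n + 7) ^ 2 * (D * a (n + 9)) := by ring
            _ ≤ a (n + 7) ^ 2 * a (n + 8) := mul_le_mul_of_nonneg_left s1' (sq_nonneg _)
        nlinarith [sq_nonneg (a (n + 8)), pow_pos h8 3]
    have hpow : (8 : ℝ) ^ (n + 6) = 8 * 8 ^ (n + 5) := by rw [pow_succ]; ring
    have hD0' : (0 : ℝ) < D := by linarith
    rw [show n + 6 + 2 = n + 8 by ring, show n + 5 + 2 = n + 7 by ring, hpow]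
    rw [show 8 / D * (8 ^ (n + 5) * a (n + 7) ^ 2) = 8 * 8 ^ (n + 5) * (a (n + 7) ^ 2 / D) by
      field_simp]
    apply mul_le_mul_of_nonneg_left _ (by positivity)
    rw [le_div_iff₀ hD0']; linarith

/-- F3 (exact one-step identity): `sh (j+1)·B(j+2)·a(j+2)² = 8·sh j·B(j+1)·a(j+3)²`
(both sides equal `8^{j+1} a(j+2)² a(j+3)²`). -/
theorem sh_succ_identity (h : HarvestData a B) (j : ℕ) :
    sh a B (j + 1) * B (j + 2) * a (j + 2) ^ 2 = 8 * sh a B j * B (j + 1) * a (j + 3) ^ 2 := by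
  have hB1 : B (j + 1) ≠ 0 := (B_pos' h _).ne'
  have hB2 : B (j + 2) ≠ 0 := (B_pos' h _).ne'
  unfold sh
  rw [show j + 1 + 2 = j + 3 by ring, show j + 1 + 1 = j + 2 by ring]
  field_simp
  ring

/-- F3 (upper form): `sh (j+1) ≤ 8·sh j` (`a` antitone, `B` monotone). -/
theorem sh_succ_le (h : HarvestData a B) (j : ℕ) : sh a B (j + 1) ≤ 8 * sh a B j := by
  apply sh_le_of_num_le h (by omega) (by norm_num)
  rw [show j + 1 + 2 = j + 3 by ring, pow_succ]
  have ha : a (j + 3) ≤ a (j + 2) := h.a_anti (by omega)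
  have ha' : a (j + 3) ^ 2 ≤ a (j + 2) ^ 2 := pow_le_pow_left₀ (h.a_pos _).le ha 2
  have : (0 : ℝ) ≤ 8 ^ j := by positivity
  nlinarith [mul_le_mul_of_nonneg_left ha' this]

/-- (ii) DECAY SEPARATION ACROSS ONE BLOCK: if block boundaries `m₁ ≤ m₂` satisfy the greedy
stopping rule `a(m₂-2) ≤ τ·a(m₁+2)`, then every `k < m₁` and every `ℓ ≥ m₂` are τ-decay-separated:
`a(ℓ-2) ≤ τ·a(k+2)`. -/
theorem decay_sep_of_blocks (h : HarvestData a B) {τ : ℝ} (hτ : 0 ≤ τ) {m₁ m₂ k ℓ : ℕ}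
    (hk : k < m₁) (hℓ : m₂ ≤ ℓ) (hsep : a (m₂ - 2) ≤ τ * a (m₁ + 2)) :
    a (ℓ - 2) ≤ τ * a (k + 2) :=
  calc a (ℓ - 2) ≤ a (m₂ - 2) := h.a_anti (Nat.sub_le_sub_right hℓ 2)
    _ ≤ τ * a (m₁ + 2) := hsep
    _ ≤ τ * a (k + 2) := mul_le_mul_of_nonneg_left (h.a_anti (by omega)) hτ

/-- PIGEONHOLE ON RESIDUES: if a finite family of scales carries total weight at least `L·M`
(`L ≥ 1`), some residue class mod `L` carries at least `M` (averaging). -/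
theorem exists_residue_class {𝒦 : Finset ℕ} {f : ℕ → ℝ} {L : ℕ} (hL : 1 ≤ L)
    {M : ℝ} (hM : (L : ℝ) * M ≤ ∑ k ∈ 𝒦, f k) :
    ∃ r, r < L ∧ M ≤ ∑ k ∈ 𝒦.filter (fun k => k % L = r), f k := by
  classical
  have hfib : ∑ r ∈ range L, ∑ k ∈ 𝒦.filter (fun k => k % L = r), f k = ∑ k ∈ 𝒦, f k :=
    sum_fiberwise_of_maps_to (g := fun k => k % L) (fun k _ => mem_range.2 (Nat.mod_lt k hL)) f
  by_contra hno
  push Not at hno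
  have hlt : ∑ r ∈ range L, ∑ k ∈ 𝒦.filter (fun k => k % L = r), f k < ∑ _r ∈ range L, M :=
    sum_lt_sum_of_nonempty (nonempty_range_iff.2 (by omega)) fun r hr => hno r (mem_range.1 hr)
  rw [hfib, sum_const, card_range, nsmul_eq_mul] at hlt
  linarith

/-- INDEX SEPARATION INSIDE A RESIDUE CLASS: two distinct scales in the same residue class mod `L`
differ by at least `L`, so `2^{k+1} ≤ τ·2^ℓ` as soon as `2 ≤ τ·2^L`. -/
theorem index_sep_of_residue {τ : ℝ} {L k ℓ : ℕ} (hτL : (2 : ℝ) ≤ τ * 2 ^ L)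
    (hkℓ : k < ℓ) (hres : k % L = ℓ % L) : (2 : ℝ) ^ (k + 1) ≤ τ * 2 ^ ℓ := by
  have hdvd : L ∣ ℓ - k := (Nat.modEq_iff_dvd' hkℓ.le).1 hres
  have hLle : L ≤ ℓ - k := by
    rcases Nat.eq_zero_or_pos L with rfl | hL
    · exact Nat.zero_le _
    · exact Nat.le_of_dvd (by omega) hdvd
  obtain ⟨d, hd⟩ : ∃ d, ℓ = k + L + d := ⟨ℓ - k - L, by omega⟩
  subst hd
  have h2 : (0 : ℝ) < 2 ^ k := by positivity
  calc (2 : ℝ) ^ (k + 1) = 2 ^ k * 2 := by rw [pow_succ]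
    _ ≤ 2 ^ k * (τ * 2 ^ L) := mul_le_mul_of_nonneg_left hτL h2.le
    _ ≤ 2 ^ k * (τ * 2 ^ L) * 2 ^ d := le_mul_of_one_le_right (by
          have : (0:ℝ) ≤ τ * 2 ^ L := by linarith
          positivity) (one_le_pow₀ (by norm_num))
    _ = τ * 2 ^ (k + L + d) := by rw [pow_add, pow_add]; ring

/-- For every `τ > 0` there is `L ≥ 1` with `2 ≤ τ·2^L`. -/
theorem exists_residue_modulus {τ : ℝ} (hτ : 0 < τ) : ∃ L : ℕ, 1 ≤ L ∧ (2 : ℝ) ≤ τ * 2 ^ L := by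
  obtain ⟨n, hn⟩ := pow_unbounded_of_one_lt (2 / τ) (by norm_num : (1 : ℝ) < 2)
  refine ⟨n + 1, by omega, ?_⟩
  rw [div_lt_iff₀ hτ] at hn
  rw [pow_succ]
  nlinarith

/-! ### Blocks (greedy τ-chain), block index, ancestor chains, flat iteration -/

section Blocks

attribute [local instance] Classical.propDecidable

/-- A next greedy block start exists after every `m` (`a → 0`, `τ·a(m+2) > 0`). -/
theorem exists_next (h : HarvestData a B) {τ : ℝ} (hτ : 0 < τ) (m : ℕ) :
    ∃ ℓ : ℕ, m + 4 < ℓ ∧ a (ℓ - 2) ≤ τ * a (m + 2) := by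
  have hpos : 0 < τ * a (m + 2) := mul_pos hτ (h.a_pos _)
  have hev := h.a_tendsto.eventually_lt_const hpos
  rw [eventually_atTop] at hev
  obtain ⟨N, hN⟩ := hev
  refine ⟨max N (m + 5) + 2, by omega, ?_⟩
  rw [Nat.add_sub_cancel]
  exact (hN _ (le_max_left _ _)).le

/-- The next greedy block start after `m`: the least `ℓ > m + 4` with `a(ℓ-2) ≤ τ·a(m+2)`. -/
noncomputable def nextStart (h : HarvestData a B) {τ : ℝ} (hτ : 0 < τ) (m : ℕ) : ℕ :=
  Nat.find (exists_next h hτ m)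

/-- The defining property of `nextStart`. -/
theorem nextStart_spec (h : HarvestData a B) {τ : ℝ} (hτ : 0 < τ) (m : ℕ) :
    m + 4 < nextStart h hτ m ∧ a (nextStart h hτ m - 2) ≤ τ * a (m + 2) :=
  Nat.find_spec (exists_next h hτ m)

/-- Minimality of `nextStart`: strictly before it the sequence is τ-flat. -/
theorem nextStart_flat (h : HarvestData a B) {τ : ℝ} (hτ : 0 < τ) (m : ℕ) {ℓ : ℕ}
    (h1 : m + 4 < ℓ) (h2 : ℓ < nextStart h hτ m) : τ * a (m + 2) < a (ℓ - 2) := by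
  have hmin := Nat.find_min (exists_next h hτ m) h2
  by_contra hle
  exact hmin ⟨h1, not_lt.1 hle⟩

/-- The greedy block starts `m₀ = blk 0 < blk 1 < …`. -/
noncomputable def blk (h : HarvestData a B) {τ : ℝ} (hτ : 0 < τ) (m₀ : ℕ) : ℕ → ℕ
  | 0 => m₀
  | i + 1 => nextStart h hτ (blk h hτ m₀ i)

variable (h : HarvestData a B) {τ : ℝ} (hτ : 0 < τ) (m₀ : ℕ)

/-- `blk 0 = m₀`. -/
theorem blk_zero : blk h hτ m₀ 0 = m₀ := rfl

/-- `blk (i+1)` is the next greedy start after `blk i`. -/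
theorem blk_succ (i : ℕ) : blk h hτ m₀ (i + 1) = nextStart h hτ (blk h hτ m₀ i) := rfl

/-- Blocks have length at least 5. -/
theorem blk_lt_succ (i : ℕ) : blk h hτ m₀ i + 4 < blk h hτ m₀ (i + 1) :=
  (nextStart_spec h hτ _).1

/-- The greedy stopping rule at each block start. -/
theorem blk_sep (i : ℕ) : a (blk h hτ m₀ (i + 1) - 2) ≤ τ * a (blk h hτ m₀ i + 2) :=
  (nextStart_spec h hτ _).2

/-- τ-flatness strictly inside a block. -/
theorem blk_flat (i : ℕ) {ℓ : ℕ} (h1 : blk h hτ m₀ i + 4 < ℓ) (h2 : ℓ < blk h hτ m₀ (i + 1)) :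
    τ * a (blk h hτ m₀ i + 2) < a (ℓ - 2) :=
  nextStart_flat h hτ _ h1 h2

/-- `blk i ≥ m₀ + 5i`. -/
theorem blk_ge (i : ℕ) : m₀ + 5 * i ≤ blk h hτ m₀ i := by
  induction i with
  | zero => simp [blk_zero]
  | succ i ih => have := blk_lt_succ h hτ m₀ i; omega

/-- Block starts increase strictly. -/
theorem blk_strictMono : StrictMono (blk h hτ m₀) :=
  strictMono_nat_of_lt_succ fun i => by have := blk_lt_succ h hτ m₀ i; omega

/-- Block starts are monotone. -/
theorem blk_le_of_le {i j : ℕ} (hij : i ≤ j) : blk h hτ m₀ i ≤ blk h hτ m₀ j :=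
  (blk_strictMono h hτ m₀).monotone hij

/-- Gaps between block starts: `blk i + 5·d ≤ blk (i + d)`. -/
theorem blk_add_ge (i d : ℕ) : blk h hτ m₀ i + 5 * d ≤ blk h hτ m₀ (i + d) := by
  induction d with
  | zero => simp
  | succ d ih => have := blk_lt_succ h hτ m₀ (i + d); rw [← add_assoc]; omega

/-- Every scale `k ≥ m₀` lies in a unique block `[blk i, blk (i+1))`. -/
theorem exists_blk_index {k : ℕ} (hk : m₀ ≤ k) :
    ∃ i, blk h hτ m₀ i ≤ k ∧ k < blk h hτ m₀ (i + 1) := by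
  have hex : ∃ i, k < blk h hτ m₀ (i + 1) := ⟨k, by have := blk_ge h hτ m₀ (k + 1); omega⟩
  refine ⟨Nat.find hex, ?_, Nat.find_spec hex⟩
  rcases Nat.eq_zero_or_pos (Nat.find hex) with h0 | hpos
  · rw [h0, blk_zero]; exact hk
  · have hmin := Nat.find_min hex (Nat.sub_one_lt_of_lt hpos)
    rw [Nat.sub_one_add_one_eq_of_pos hpos] at hmin
    exact not_lt.1 hmin

/-- Separation of scales in blocks at distance ≥ 2: `k < blk (i+1)`, `blk j ≤ ℓ`, `i + 2 ≤ j`. -/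
theorem sep_of_blk {i j k ℓ : ℕ} (hτ1 : 0 ≤ τ) (hk : k < blk h hτ m₀ (i + 1)) (hj : i + 2 ≤ j)
    (hℓ : blk h hτ m₀ j ≤ ℓ) : a (ℓ - 2) ≤ τ * a (k + 2) := by
  refine decay_sep_of_blocks h hτ1 hk ((blk_le_of_le h hτ m₀ hj).trans hℓ) ?_
  rw [show i + 2 = (i + 1) + 1 by ring]
  exact blk_sep h hτ m₀ (i + 1)

end Blocks

/-! ### Ancestor chains -/

/-- Iterating the ancestor lemma: every scale `k ≥ 1` has a "windowed-or-small" ancestor `w`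
(`1 ≤ w ≤ k`, `k ≤ w + 6c`) with `sh k·(D/8)^c ≤ sh w`, where either `w` is `D^16`-windowed or `w < 7`. -/
theorem chain (h : HarvestData a B) {D : ℝ} (hD : 32 ≤ D) :
    ∀ k : ℕ, 1 ≤ k → ∃ w c : ℕ, 1 ≤ w ∧ w ≤ k ∧ k ≤ w + 6 * c ∧
      sh a B k * (D / 8) ^ c ≤ sh a B w ∧ (a (w - 4) ≤ D ^ 16 * a (w + 4) ∨ w < 7) := by
  intro k
  induction k using Nat.strong_induction_on with
  | _ k ih =>
    intro hk1
    by_cases hstop : a (k - 4) ≤ D ^ 16 * a (k + 4) ∨ k < 7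
    · exact ⟨k, 0, hk1, le_rfl, by omega, by simp, hstop⟩
    · push Not at hstop
      obtain ⟨hnw, hk7⟩ := hstop
      obtain ⟨k', hk'1, hk'2, hsh⟩ := ancestor h hD (by omega) hnw
      obtain ⟨w, c, hw1, hwk, hkw, hchain, hend⟩ := ih k' hk'2 (by omega)
      refine ⟨w, c + 1, hw1, by omega, by omega, ?_, hend⟩
      have hD8 : (0 : ℝ) ≤ D / 8 := by positivity
      have step : sh a B k * (D / 8) ≤ sh a B k' := by
        have hD0 : (0 : ℝ) < D := by linarith
        calc sh a B k * (D / 8) ≤ 8 / D * sh a B k' * (D / 8) :=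
              mul_le_mul_of_nonneg_right hsh hD8
          _ = sh a B k' := by field_simp
      calc sh a B k * (D / 8) ^ (c + 1) = sh a B k * (D / 8) * (D / 8) ^ c := by rw [pow_succ]; ring
        _ ≤ sh a B k' * (D / 8) ^ c := mul_le_mul_of_nonneg_right step (pow_nonneg hD8 _)
        _ ≤ sh a B w := hchain

/-! ### Flat iteration (F3 lower form, iterated) -/

/-- One step: if `sh (j-1) ≤ 1/9728` (`j ≥ 1`) then `4·sh j·a(j+3)² ≤ sh (j+1)·a(j+2)²`. -/
theorem four_mul_sh_le (h : HarvestData a B) {j : ℕ} (hj : 1 ≤ j)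
    (hun : sh a B (j - 1) ≤ 1 / 9728) :
    4 * sh a B j * a (j + 3) ^ 2 ≤ sh a B (j + 1) * a (j + 2) ^ 2 := by
  obtain ⟨i, rfl⟩ : ∃ i, j = i + 1 := ⟨j - 1, by omega⟩
  rw [Nat.add_sub_cancel] at hun
  have hB : B (i + 3) ≤ 2 * B (i + 2) := by
    have := B_add_three_le h i
    have hB2 : 0 ≤ B (i + 2) := (B_pos' h _).le
    nlinarith [mul_le_mul_of_nonneg_right hun hB2]
  have hid := sh_succ_identity h (i + 1)
  rw [show i + 1 + 1 = i + 2 by ring, show i + 1 + 2 = i + 3 by ring, show i + 1 + 3 = i + 4 by ring]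
    at hid ⊢
  -- hid : sh (i+2) * B (i+3) * a (i+3)^2 = 8 * sh (i+1) * B (i+2) * a (i+4)^2
  have hB3 : 0 < B (i + 3) := B_pos' h _
  have hsh2 : 0 ≤ sh a B (i + 2) * a (i + 3) ^ 2 := mul_nonneg (sh_nonneg h _) (sq_nonneg _)
  -- sh(i+2) a(i+3)^2 * B(i+3) ≥ sh(i+2) a(i+3)^2 * ... we compare using B(i+3) ≤ 2 B(i+2)
  have key : 8 * sh a B (i + 1) * a (i + 4) ^ 2 * B (i + 2) ≤
      sh a B (i + 2) * a (i + 3) ^ 2 * (2 * B (i + 2)) := by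
    calc 8 * sh a B (i + 1) * a (i + 4) ^ 2 * B (i + 2)
        = sh a B (i + 2) * a (i + 3) ^ 2 * B (i + 3) := by rw [← mul_right_comm, ← hid]; ring
      _ ≤ sh a B (i + 2) * a (i + 3) ^ 2 * (2 * B (i + 2)) := mul_le_mul_of_nonneg_left hB hsh2
  have hB2 : 0 < B (i + 2) := B_pos' h _
  nlinarith

/-- Iterated: `4^n·sh k·a(k+n+2)² ≤ sh (k+n)·a(k+2)²` whenever `sh ≤ 1/9728` on `[k-1, k+n-2]` (`k ≥ 1`). -/
theorem pow_four_mul_sh_le (h : HarvestData a B) {k : ℕ} (hk : 1 ≤ k) :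
    ∀ n : ℕ, (∀ j, k ≤ j → j < k + n → sh a B (j - 1) ≤ 1 / 9728) →
      4 ^ n * sh a B k * a (k + n + 2) ^ 2 ≤ sh a B (k + n) * a (k + 2) ^ 2 := by
  intro n
  induction n with
  | zero => intro _; simp
  | succ n ih =>
    intro hun
    have hP := ih fun j hj1 hj2 => hun j hj1 (by omega)
    have hstep := four_mul_sh_le h (j := k + n) (by omega) (hun (k + n) (by omega) (by omega))
    -- hstep : 4 * sh (k+n) * a (k+n+3)^2 ≤ sh (k+n+1) * a (k+n+2)^2
    have ha : 0 < a (k + n + 2) ^ 2 := pow_pos (h.a_pos _) 2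
    have ha3 : 0 ≤ a (k + n + 3) ^ 2 := sq_nonneg _
    -- multiply hP by 4 a(k+n+3)^2 and hstep by a(k+2)^2, cancel a(k+n+2)^2
    have h1 : 4 ^ (n + 1) * sh a B k * a (k + (n + 1) + 2) ^ 2 * a (k + n + 2) ^ 2
        = (4 ^ n * sh a B k * a (k + n + 2) ^ 2) * (4 * a (k + n + 3) ^ 2) := by
      rw [pow_succ, show k + (n + 1) + 2 = k + n + 3 by ring]; ring
    have h2 : (4 ^ n * sh a B k * a (k + n + 2) ^ 2) * (4 * a (k + n + 3) ^ 2)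
        ≤ (sh a B (k + n) * a (k + 2) ^ 2) * (4 * a (k + n + 3) ^ 2) :=
      mul_le_mul_of_nonneg_right hP (by positivity)
    have h3 : (sh a B (k + n) * a (k + 2) ^ 2) * (4 * a (k + n + 3) ^ 2)
        = (4 * sh a B (k + n) * a (k + n + 3) ^ 2) * a (k + 2) ^ 2 := by ring
    have h4 : (4 * sh a B (k + n) * a (k + n + 3) ^ 2) * a (k + 2) ^ 2
        ≤ (sh a B (k + n + 1) * a (k + n + 2) ^ 2) * a (k + 2) ^ 2 :=
      mul_le_mul_of_nonneg_right hstep (sq_nonneg _)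
    have h5 : 4 ^ (n + 1) * sh a B k * a (k + (n + 1) + 2) ^ 2 * a (k + n + 2) ^ 2
        ≤ (sh a B (k + (n + 1)) * a (k + 2) ^ 2) * a (k + n + 2) ^ 2 := by
      rw [h1, show k + (n + 1) = k + n + 1 by ring]
      calc _ ≤ _ := h2
        _ = _ := h3
        _ ≤ _ := h4
        _ = _ := by ring
    exact le_of_mul_le_mul_right h5 ha

/-! ### The unsaturated-block lemma (iii) -/

section BlockLemma

attribute [local instance] Classical.propDecidable

variable (h : HarvestData a B) {τ : ℝ} (hτ : 0 < τ) (m₀ : ℕ)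

/-- Core comparison inside an unsaturated block: for `blk i ≤ k ≤ e := blk(i+1) - 5`,
`τ²·4^{e-k}·sh k ≤ sh e`. -/
theorem core_le (hτ1 : τ ≤ 1) (hm₀ : 1 ≤ m₀) (i : ℕ)
    (hun : ∀ j, blk h hτ m₀ i ≤ j + 1 → j + 7 ≤ blk h hτ m₀ (i + 1) → sh a B j ≤ 1 / 9728)
    {k : ℕ} (hk1 : blk h hτ m₀ i ≤ k) (hk2 : k + 5 ≤ blk h hτ m₀ (i + 1)) :
    τ ^ 2 * 4 ^ (blk h hτ m₀ (i + 1) - 5 - k) * sh a B k ≤ sh a B (blk h hτ m₀ (i + 1) - 5) := by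
  set m := blk h hτ m₀ i with hm
  set m' := blk h hτ m₀ (i + 1) with hm'
  have hmm' : m + 4 < m' := blk_lt_succ h hτ m₀ i
  have hm1 : m₀ ≤ m := by have := blk_ge h hτ m₀ i; omega
  by_cases hke : k = m' - 5
  · have : m' - 5 - k = 0 := by omega
    rw [this, pow_zero, mul_one, hke]
    have hs := sh_nonneg h (m' - 5)
    have hτ2 : τ ^ 2 ≤ 1 := pow_le_one₀ hτ.le hτ1
    nlinarith
  · have hlt : k < m' - 5 := by omega
    set n := m' - 5 - k with hn
    have hkn : k + n = m' - 5 := by omega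
    have hflat := blk_flat h hτ m₀ i (ℓ := m' - 1) (by omega) (by omega)
    rw [show m' - 1 - 2 = k + n + 2 by omega] at hflat
    -- hflat : τ * a (m + 2) < a (k + n + 2)
    have hP := pow_four_mul_sh_le h (k := k) (by omega) n
      (fun j hj1 hj2 => by
        have := hun (j - 1) (by omega) (by omega)
        exact this)
    -- hP : 4 ^ n * sh k * a (k + n + 2) ^ 2 ≤ sh (k + n) * a (k + 2) ^ 2
    rw [hkn] at hP hflat
    have hak : a (k + 2) ≤ a (blk h hτ m₀ i + 2) := h.a_anti (by omega)
    have hak2 : a (k + 2) ^ 2 ≤ a (blk h hτ m₀ i + 2) ^ 2 := pow_le_pow_left₀ (h.a_pos _).le hak 2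
    have ham : 0 < a (blk h hτ m₀ i + 2) := h.a_pos _
    have hτa : 0 ≤ τ * a (blk h hτ m₀ i + 2) := by positivity
    have hfl2 : (τ * a (blk h hτ m₀ i + 2)) ^ 2 ≤ a (m' - 5 + 2) ^ 2 :=
      pow_le_pow_left₀ hτa hflat.le 2
    have hshk : 0 ≤ 4 ^ n * sh a B k := mul_nonneg (pow_nonneg (by norm_num) _) (sh_nonneg h _)
    have hshe : 0 ≤ sh a B (m' - 5) := sh_nonneg h _
    have key : (τ ^ 2 * 4 ^ n * sh a B k) * a (blk h hτ m₀ i + 2) ^ 2 ≤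
        sh a B (m' - 5) * a (blk h hτ m₀ i + 2) ^ 2 :=
      calc (τ ^ 2 * 4 ^ n * sh a B k) * a (blk h hτ m₀ i + 2) ^ 2
          = (4 ^ n * sh a B k) * (τ * a (blk h hτ m₀ i + 2)) ^ 2 := by ring
        _ ≤ (4 ^ n * sh a B k) * a (m' - 5 + 2) ^ 2 := mul_le_mul_of_nonneg_left hfl2 hshk
        _ = 4 ^ n * sh a B k * a (m' - 5 + 2) ^ 2 := by ring
        _ ≤ sh a B (m' - 5) * a (k + 2) ^ 2 := hP
        _ ≤ sh a B (m' - 5) * a (blk h hτ m₀ i + 2) ^ 2 := mul_le_mul_of_nonneg_left hak2 hshe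
    exact le_of_mul_le_mul_right key (pow_pos ham 2)

/-- The geometric factor of the core: `Σ_{k ∈ [m, e]} (1/4)^{e-k} ≤ 4/3`. -/
theorem geom_core_le (m e : ℕ) : ∑ k ∈ Ico m (e + 1), (1 / 4 : ℝ) ^ (e - k) ≤ 4 / 3 := by
  have hinj : Set.InjOn (fun k => e - k) ↑(Ico m (e + 1)) := by
    intro x hx y hy hxy
    simp only [coe_Ico, Set.mem_Ico] at hx hy
    simp only at hxy
    omega
  rw [← sum_image (f := fun j => (1 / 4 : ℝ) ^ j) hinj]
  have hsub : (Ico m (e + 1)).image (fun k => e - k) ⊆ range (e + 1) := by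
    intro j hj
    simp only [mem_image, mem_Ico] at hj
    obtain ⟨k, hk, rfl⟩ := hj
    simp only [mem_range]; omega
  calc ∑ j ∈ (Ico m (e + 1)).image (fun k => e - k), (1 / 4 : ℝ) ^ j
      ≤ ∑ j ∈ range (e + 1), (1 / 4 : ℝ) ^ j :=
        sum_le_sum_of_subset_of_nonneg hsub fun _ _ _ => by positivity
    _ ≤ (1 / 4 : ℝ) ^ 0 / (1 - 1 / 4) := by
        rw [range_eq_Ico]; exact geom_sum_Ico_le_of_lt_one (by norm_num) (by norm_num)
    _ = 4 / 3 := by norm_num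

/-- (iii) UNSATURATED-BLOCK LEMMA: if `sh ≤ 1/9728` on `[blk i - 1, blk(i+1) - 7]` then
`Σ_{k ∈ block i} sh k ≤ (4/(3τ²) + 4680)·sh (blk(i+1) - 5)`. -/
theorem block_sum_le (hτ1 : τ ≤ 1) (hm₀ : 1 ≤ m₀) (i : ℕ)
    (hun : ∀ j, blk h hτ m₀ i ≤ j + 1 → j + 7 ≤ blk h hτ m₀ (i + 1) → sh a B j ≤ 1 / 9728) :
    ∑ k ∈ Ico (blk h hτ m₀ i) (blk h hτ m₀ (i + 1)), sh a B k
      ≤ (4 / (3 * τ ^ 2) + 4680) * sh a B (blk h hτ m₀ (i + 1) - 5) := by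
  set m := blk h hτ m₀ i with hm
  set m' := blk h hτ m₀ (i + 1) with hm'
  have hmm' : m + 4 < m' := blk_lt_succ h hτ m₀ i
  set e := m' - 5 with he
  have hm'e : m' = e + 5 := by omega
  have hse : 0 ≤ sh a B e := sh_nonneg h _
  -- split core / tail
  rw [hm'e, ← sum_Ico_consecutive _ (show m ≤ e + 1 by omega) (show e + 1 ≤ e + 5 by omega)]
  -- core
  have hcore : ∑ k ∈ Ico m (e + 1), sh a B k ≤ 4 / (3 * τ ^ 2) * sh a B e := by
    have hτ2 : 0 < τ ^ 2 := by positivity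
    calc ∑ k ∈ Ico m (e + 1), sh a B k
        ≤ ∑ k ∈ Ico m (e + 1), (1 / τ ^ 2 * sh a B e) * (1 / 4 : ℝ) ^ (e - k) := by
          apply sum_le_sum
          intro k hk
          rw [mem_Ico] at hk
          have hc := core_le h hτ m₀ hτ1 hm₀ i hun (k := k) hk.1 (by omega)
          rw [← he] at hc
          -- hc : τ^2 * 4^(e-k) * sh k ≤ sh e
          have h4 : (0 : ℝ) < 4 ^ (e - k) := by positivity
          rw [show (1 / τ ^ 2 * sh a B e) * (1 / 4 : ℝ) ^ (e - k) = sh a B e / (τ ^ 2 * 4 ^ (e - k)) by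
            rw [one_div_pow]; field_simp]
          rw [le_div_iff₀ (by positivity)]
          linarith
      _ = (1 / τ ^ 2 * sh a B e) * ∑ k ∈ Ico m (e + 1), (1 / 4 : ℝ) ^ (e - k) := by rw [mul_sum]
      _ ≤ (1 / τ ^ 2 * sh a B e) * (4 / 3) :=
          mul_le_mul_of_nonneg_left (geom_core_le m e) (by positivity)
      _ = 4 / (3 * τ ^ 2) * sh a B e := by field_simp
  -- tail: e+1 .. e+4
  have htail : ∑ k ∈ Ico (e + 1) (e + 5), sh a B k ≤ 4680 * sh a B e := by
    have h1 := sh_succ_le h e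
    have h2 := sh_succ_le h (e + 1)
    have h3 := sh_succ_le h (e + 2)
    have h4 := sh_succ_le h (e + 3)
    simp only [sum_Ico_succ_top (show e + 1 ≤ e + 4 by omega), sum_Ico_succ_top (show e + 1 ≤ e + 3 by omega),
      sum_Ico_succ_top (show e + 1 ≤ e + 2 by omega), sum_Ico_succ_top (show e + 1 ≤ e + 1 by omega),
      Ico_self, sum_empty, zero_add]
    rw [show e + 3 + 1 = e + 4 by ring] at h4
    rw [show e + 2 + 1 = e + 3 by ring] at h3
    rw [show e + 1 + 1 = e + 2 by ring] at h2
    linarith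
  linarith

end BlockLemma

/-! ### Decay-separated windowed families and the endgame -/

/- A "decay family" below is a finite family of `A`-windowed scales `≥ k₀`, pairwise `τ`-DECAY-separated,
of total share `≥ M` (stated inline; no auxiliary `def … : Prop`). -/

/-- ENDGAME: decay-separated families of every size for `τ' = min τ 1` give the full conclusion of
`AbstractHarvest` at `τ` (residue pigeonhole for the index separation). -/
theorem harvest_of_decayFamily (h : HarvestData a B) {A τ : ℝ} (hτ : 0 < τ) (k₀ : ℕ)
    (hfam : ∀ M' : ℝ, ∃ 𝒦 : Finset ℕ, (∀ k ∈ 𝒦, k₀ ≤ k ∧ a (k - 4) ≤ A * a (k + 4)) ∧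
      (∀ k ∈ 𝒦, ∀ ℓ ∈ 𝒦, k < ℓ → a (ℓ - 2) ≤ min τ 1 * a (k + 2)) ∧ M' ≤ ∑ k ∈ 𝒦, sh a B k)
    (M : ℝ) :
    ∃ 𝒦 : Finset ℕ, (∀ k ∈ 𝒦, k₀ ≤ k ∧ a (k - 4) ≤ A * a (k + 4)) ∧
      (∀ k ∈ 𝒦, ∀ ℓ ∈ 𝒦, k < ℓ → a (ℓ - 2) ≤ τ * a (k + 2) ∧ (2 : ℝ) ^ (k + 1) ≤ τ * 2 ^ ℓ) ∧
      M ≤ ∑ k ∈ 𝒦, (8 : ℝ) ^ k * a (k + 2) ^ 2 / B (k + 1) := by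
  classical
  set τ' := min τ 1 with hτ'
  have hτ'0 : 0 < τ' := lt_min hτ one_pos
  have hτ'τ : τ' ≤ τ := min_le_left _ _
  obtain ⟨L, hL1, hL⟩ := exists_residue_modulus hτ'0
  obtain ⟨𝒦', hwin, hsep, hM⟩ := hfam ((L : ℝ) * M)
  obtain ⟨r, -, hr⟩ := exists_residue_class (𝒦 := 𝒦') (f := sh a B) hL1 hM
  refine ⟨𝒦'.filter (fun k => k % L = r), fun k hk => hwin k (mem_filter.1 hk).1, ?_, ?_⟩
  · intro k hk ℓ hℓ hkℓ
    rw [mem_filter] at hk hℓ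
    refine ⟨(hsep k hk.1 ℓ hℓ.1 hkℓ).trans
      (mul_le_mul_of_nonneg_right hτ'τ (h.a_pos _).le), ?_⟩
    have := index_sep_of_residue hL hkℓ (hk.2.trans hℓ.2.symm)
    exact this.trans (mul_le_mul_of_nonneg_right hτ'τ (by positivity))
  · simpa [sh] using hr

/-! ### Case A: infinitely many big shares -/

section CaseA

attribute [local instance] Classical.propDecidable

/-- In Case A (shares `≥ 1/9728` beyond every index) there are decay-separated windowed families of
every cardinality `N` whose members all have share `≥ 1/9728`. -/
theorem caseA_family (h : HarvestData a B) {τ : ℝ} (hτ : 0 < τ) (m₀ : ℕ) (hm₀ : 7 ≤ m₀)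
    (hA : ∀ n : ℕ, ∃ k, n ≤ k ∧ 1 / 9728 ≤ sh a B k) (N : ℕ) :
    ∃ 𝒦 : Finset ℕ, 𝒦.card = N ∧ (∀ k ∈ 𝒦, m₀ ≤ k ∧ a (k - 4) ≤ (128 : ℝ) ^ 16 * a (k + 4)) ∧
      (∀ k ∈ 𝒦, ∀ ℓ ∈ 𝒦, k < ℓ → a (ℓ - 2) ≤ τ * a (k + 2)) ∧
      (∀ k ∈ 𝒦, 1 / 9728 ≤ sh a B k) ∧ ∃ i, ∀ k ∈ 𝒦, k < blk h hτ m₀ (i + 1) := by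
  induction N with
  | zero => exact ⟨∅, rfl, by simp, by simp, by simp, 0, by simp⟩
  | succ N ih =>
    obtain ⟨𝒦, hcard, hwin, hsep, hbig, i, hbound⟩ := ih
    -- a big share far beyond block i+2
    obtain ⟨k, hk, hkbig⟩ := hA (blk h hτ m₀ (i + 2) + 12)
    have hk1 : 1 ≤ k := by have := blk_ge h hτ m₀ (i + 2); omega
    obtain ⟨w, c, hw1, hwk, hkw, hchain, hend⟩ := chain h (D := 128) (by norm_num) k hk1
    -- chain length ≤ 2 (shares are ≤ 1/7)
    have hc : c ≤ 2 := by
      by_contra hc3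
      push Not at hc3
      have h16 : (16 : ℝ) ^ 3 ≤ (128 / 8 : ℝ) ^ c := by
        rw [show (128 / 8 : ℝ) = 16 by norm_num]
        exact pow_le_pow_right₀ (by norm_num) (by omega)
      have hsw : sh a B w ≤ 1 / 7 := sh_le h hw1
      have : sh a B k * 16 ^ 3 ≤ 1 / 7 :=
        (mul_le_mul_of_nonneg_left h16 (sh_nonneg h _)).trans (hchain.trans hsw)
      nlinarith
    have hwge : blk h hτ m₀ (i + 2) ≤ w := by omega
    have hwm₀ : m₀ ≤ w := by have := blk_ge h hτ m₀ (i + 2); omega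
    have hwwin : a (w - 4) ≤ (128 : ℝ) ^ 16 * a (w + 4) := by
      rcases hend with hwin' | hsmall
      · exact hwin'
      · omega
    have hwbig : 1 / 9728 ≤ sh a B w := by
      have h1 : (1 : ℝ) ≤ (128 / 8 : ℝ) ^ c := one_le_pow₀ (by norm_num)
      have := mul_le_mul_of_nonneg_left h1 (sh_nonneg h k)
      rw [mul_one] at this
      exact hkbig.trans (this.trans hchain)
    have hwnot : w ∉ 𝒦 := fun hw => by have := hbound w hw; have := blk_le_of_le h hτ m₀ (show i + 1 ≤ i + 2 by omega); omega
    obtain ⟨i', -, hi'⟩ := exists_blk_index h hτ m₀ hwm₀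
    refine ⟨insert w 𝒦, by rw [card_insert_of_notMem hwnot, hcard], ?_, ?_, ?_, max i i', ?_⟩
    · intro x hx
      rcases mem_insert.1 hx with rfl | hx
      · exact ⟨hwm₀, hwwin⟩
      · exact hwin x hx
    · intro x hx y hy hxy
      rw [mem_insert] at hx hy
      rcases hx with hxw | hx
      · rcases hy with hyw | hy
        · rw [hxw, hyw] at hxy; exact absurd hxy (lt_irrefl _)
        · -- x = w new, y old: y < blk (i+1) ≤ blk (i+2) ≤ w = x < y, absurd
          rw [hxw] at hxy
          have h1 := hbound y hy
          have h2 := blk_le_of_le h hτ m₀ (show i + 1 ≤ i + 2 by omega)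
          omega
      · rcases hy with hyw | hy
        · -- x old, y = w new
          rw [hyw]
          exact sep_of_blk h hτ m₀ hτ.le (hbound x hx) le_rfl hwge
        · exact hsep x hx y hy hxy
    · intro x hx
      rcases mem_insert.1 hx with rfl | hx
      · exact hwbig
      · exact hbig x hx
    · intro x hx
      rcases mem_insert.1 hx with rfl | hx
      · exact hi'.trans_le (blk_le_of_le h hτ m₀ (by omega))
      · exact (hbound x hx).trans_le (blk_le_of_le h hτ m₀ (by omega))

/-- CASE A: decay-separated windowed families of every total share. -/
theorem caseA (h : HarvestData a B) {τ : ℝ} (hτ : 0 < τ) (k₀ : ℕ)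
    (hA : ∀ n : ℕ, ∃ k, n ≤ k ∧ 1 / 9728 ≤ sh a B k) (M : ℝ) :
    ∃ 𝒦 : Finset ℕ, (∀ k ∈ 𝒦, k₀ ≤ k ∧ a (k - 4) ≤ (128 : ℝ) ^ 16 * a (k + 4)) ∧
      (∀ k ∈ 𝒦, ∀ ℓ ∈ 𝒦, k < ℓ → a (ℓ - 2) ≤ τ * a (k + 2)) ∧ M ≤ ∑ k ∈ 𝒦, sh a B k := by
  obtain ⟨N, hN⟩ := exists_nat_gt (M * 9728)
  obtain ⟨𝒦, hcard, hwin, hsep, hbig, -⟩ := caseA_family h hτ (max k₀ 7) (le_max_right _ _) hA N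
  refine ⟨𝒦, fun k hk => ⟨(le_max_left _ _).trans (hwin k hk).1, (hwin k hk).2⟩, hsep, ?_⟩
  have hsum : (N : ℝ) * (1 / 9728) ≤ ∑ k ∈ 𝒦, sh a B k := by
    have := card_nsmul_le_sum 𝒦 (sh a B) (1 / 9728) fun k hk => hbig k hk
    rwa [hcard, nsmul_eq_mul] at this
  nlinarith

end CaseA

/-! ### Case B: eventually all shares are small -/

section CaseB

attribute [local instance] Classical.propDecidable

/-- Consecutive-block decomposition of `Σ_{k ∈ [blk 1, blk (I+1))}`. -/
theorem sum_blocks (h : HarvestData a B) {τ : ℝ} (hτ : 0 < τ) (m₀ : ℕ) (f : ℕ → ℝ) (I : ℕ) :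
    ∑ k ∈ Ico (blk h hτ m₀ 1) (blk h hτ m₀ (I + 1)), f k =
      ∑ i ∈ Ico 1 (I + 1), ∑ k ∈ Ico (blk h hτ m₀ i) (blk h hτ m₀ (i + 1)), f k := by
  induction I with
  | zero => simp
  | succ I ih =>
    rw [sum_Ico_succ_top (show 1 ≤ I + 1 by omega), ← ih]
    exact (sum_Ico_consecutive _ (blk_le_of_le h hτ m₀ (by omega))
      (blk_le_of_le h hτ m₀ (by omega))).symm

/-- `Σ_{t < n} (1/2)^t ≤ 2`. -/
theorem geom_half_le (n : ℕ) : ∑ t ∈ range n, (1 / 2 : ℝ) ^ t ≤ 2 := by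
  calc ∑ t ∈ range n, (1 / 2 : ℝ) ^ t ≤ (1 / 2 : ℝ) ^ 0 / (1 - 1 / 2) := by
        rw [range_eq_Ico]; exact geom_sum_Ico_le_of_lt_one (by norm_num) (by norm_num)
    _ = 2 := by norm_num

/-- CASE B (all shares `< 1/9728` from `K` on): decay-separated windowed families of every total share,
one representative per block of a parity class (unsaturated-block lemma + ancestor transfer). -/
theorem caseB (h : HarvestData a B) {τ : ℝ} (hτ : 0 < τ) (hτ1 : τ ≤ 1) (k₀ : ℕ) {K : ℕ}
    (hK : ∀ k, K ≤ k → sh a B k ≤ 1 / 9728) (M : ℝ) :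
    ∃ 𝒦 : Finset ℕ, (∀ k ∈ 𝒦, k₀ ≤ k ∧ a (k - 4) ≤ (128 : ℝ) ^ 16 * a (k + 4)) ∧
      (∀ k ∈ 𝒦, ∀ ℓ ∈ 𝒦, k < ℓ → a (ℓ - 2) ≤ τ * a (k + 2)) ∧ M ≤ ∑ k ∈ 𝒦, sh a B k := by
  -- the start of the block decomposition
  obtain ⟨m₀, hm₀k, hm₀7, hm₀K⟩ : ∃ m₀, k₀ ≤ m₀ ∧ 7 ≤ m₀ ∧ K + 1 ≤ m₀ :=
    ⟨max (max k₀ 7) (K + 1), le_max_of_le_left (le_max_left _ _),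
      le_max_of_le_left (le_max_right _ _), le_max_right _ _⟩
  have hm₀1 : 1 ≤ m₀ := by omega
  -- notation-free abbreviations are avoided on purpose; `blk h hτ m₀ i` is block start `i`
  have hbge : ∀ i, m₀ + 5 * i ≤ blk h hτ m₀ i := blk_ge h hτ m₀
  have he1 : ∀ i, 1 ≤ blk h hτ m₀ (i + 1) - 5 := fun i => by have := hbge (i + 1); omega
  -- ancestor chains from e i := blk (i+1) - 5
  have hch : ∀ i : ℕ, ∃ w c : ℕ, 1 ≤ w ∧ w ≤ blk h hτ m₀ (i + 1) - 5 ∧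
      blk h hτ m₀ (i + 1) - 5 ≤ w + 6 * c ∧
      sh a B (blk h hτ m₀ (i + 1) - 5) * (128 / 8 : ℝ) ^ c ≤ sh a B w ∧
      (a (w - 4) ≤ (128 : ℝ) ^ 16 * a (w + 4) ∨ w < 7) :=
    fun i => chain h (by norm_num) _ (he1 i)
  choose W C hW1 hWle hEW hchain hend using hch
  -- block index of the non-escaped chain ends
  have hJex : ∀ i, ∃ j, m₀ ≤ W i → blk h hτ m₀ j ≤ W i ∧ W i < blk h hτ m₀ (j + 1) := by
    intro i
    by_cases hi : m₀ ≤ W i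
    · obtain ⟨j, hj1, hj2⟩ := exists_blk_index h hτ m₀ hi
      exact ⟨j, fun _ => ⟨hj1, hj2⟩⟩
    · exact ⟨0, fun h' => absurd h' hi⟩
  choose J hJ using hJex
  have h16 : ∀ c : ℕ, (128 / 8 : ℝ) ^ c = 2 ^ (4 * c) := fun c => by
    rw [pow_mul]; norm_num
  -- estimate A (non-escaped): J i ≤ i and sh (e i) ≤ (1/2)^(i - J i) * sh (W i)
  have estA : ∀ i, m₀ ≤ W i →
      J i ≤ i ∧ sh a B (blk h hτ m₀ (i + 1) - 5) ≤ (1 / 2 : ℝ) ^ (i - J i) * sh a B (W i) := by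
    intro i hi
    obtain ⟨hj1, hj2⟩ := hJ i hi
    have hJi : J i ≤ i := by
      have hlt : blk h hτ m₀ (J i) < blk h hτ m₀ (i + 1) := by
        have := hWle i; omega
      have := (blk_strictMono h hτ m₀).lt_iff_lt.1 hlt
      omega
    refine ⟨hJi, ?_⟩
    -- 4 C i ≥ i - J i
    have hgap : blk h hτ m₀ (J i + 1) + 5 * (i - J i) ≤ blk h hτ m₀ (i + 1) := by
      have := blk_add_ge h hτ m₀ (J i + 1) (i - J i)
      rwa [show J i + 1 + (i - J i) = i + 1 by omega] at this
    have hC : i - J i ≤ 4 * C i := by have := hEW i; omega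
    have hpow : (2 : ℝ) ^ (i - J i) ≤ (128 / 8 : ℝ) ^ C i := by
      rw [h16]; exact pow_le_pow_right₀ (by norm_num) hC
    have hs := sh_nonneg h (blk h hτ m₀ (i + 1) - 5)
    have key : sh a B (blk h hτ m₀ (i + 1) - 5) * 2 ^ (i - J i) ≤ sh a B (W i) :=
      (mul_le_mul_of_nonneg_left hpow hs).trans (hchain i)
    rw [one_div_pow, one_div, ← div_eq_inv_mul, le_div_iff₀ (by positivity)]
    exact key
  -- estimate B (escaped): sh (e i) ≤ (1/2)^i / 7
  have estB : ∀ i, W i < m₀ → sh a B (blk h hτ m₀ (i + 1) - 5) ≤ (1 / 2 : ℝ) ^ i * (1 / 7) := by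
    intro i hi
    have hC : i ≤ 4 * C i := by have := hEW i; have := hbge (i + 1); omega
    have hpow : (2 : ℝ) ^ i ≤ (128 / 8 : ℝ) ^ C i := by
      rw [h16]; exact pow_le_pow_right₀ (by norm_num) hC
    have hs := sh_nonneg h (blk h hτ m₀ (i + 1) - 5)
    have key : sh a B (blk h hτ m₀ (i + 1) - 5) * 2 ^ i ≤ 1 / 7 :=
      ((mul_le_mul_of_nonneg_left hpow hs).trans (hchain i)).trans (sh_le h (hW1 i))
    rw [one_div_pow, one_div (2 ^ i : ℝ), ← div_eq_inv_mul, le_div_iff₀ (by positivity)]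
    linarith
  -- block sums (unsaturated everywhere beyond m₀ - 1 ≥ K)
  set Cτ : ℝ := 4 / (3 * τ ^ 2) + 4680 with hCτ
  have hCτpos : 0 < Cτ := by positivity
  have hblock : ∀ i, ∑ k ∈ Ico (blk h hτ m₀ i) (blk h hτ m₀ (i + 1)), sh a B k ≤
      Cτ * sh a B (blk h hτ m₀ (i + 1) - 5) :=
    fun i => block_sum_le h hτ m₀ hτ1 hm₀1 i
      (fun j hj1 _ => hK j (by have := hbge i; omega))
  -- choose I
  set P : ℝ := ∑ k ∈ range (blk h hτ m₀ 1), sh a B k with hP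
  set Q : ℝ := Cτ * (4 * M + 2 / 7) with hQ
  obtain ⟨N, hN⟩ := sh_sum_unbounded h (Q + P)
  set I := N with hI
  have hbI : N ≤ blk h hτ m₀ (I + 1) := by have := hbge (I + 1); omega
  have hIco : Q ≤ ∑ k ∈ Ico (blk h hτ m₀ 1) (blk h hτ m₀ (I + 1)), sh a B k := by
    have h1 : ∑ k ∈ range N, sh a B k ≤ ∑ k ∈ range (blk h hτ m₀ (I + 1)), sh a B k :=
      sum_le_sum_of_subset_of_nonneg (range_subset_range.2 hbI) fun _ _ _ => sh_nonneg h _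
    have h2 : ∑ k ∈ range (blk h hτ m₀ (I + 1)), sh a B k =
        P + ∑ k ∈ Ico (blk h hτ m₀ 1) (blk h hτ m₀ (I + 1)), sh a B k := by
      rw [range_eq_Ico, hP, range_eq_Ico]
      exact (sum_Ico_consecutive _ (Nat.zero_le _) (blk_le_of_le h hτ m₀ (by omega))).symm
    linarith
  -- the per-block estimate summed over blocks 1..I
  set T := Ico 1 (I + 1) with hT
  set S := T.filter (fun i => m₀ ≤ W i) with hS
  have hsumT : ∑ k ∈ Ico (blk h hτ m₀ 1) (blk h hτ m₀ (I + 1)), sh a B k ≤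
      Cτ * ∑ i ∈ T, sh a B (blk h hτ m₀ (i + 1) - 5) := by
    rw [sum_blocks h hτ m₀ (sh a B) I, mul_sum]
    exact sum_le_sum fun i _ => hblock i
  -- escaped part
  have hE : ∑ i ∈ T.filter (fun i => ¬ m₀ ≤ W i), sh a B (blk h hτ m₀ (i + 1) - 5) ≤ 2 / 7 := by
    calc ∑ i ∈ T.filter (fun i => ¬ m₀ ≤ W i), sh a B (blk h hτ m₀ (i + 1) - 5)
        ≤ ∑ i ∈ T.filter (fun i => ¬ m₀ ≤ W i), (1 / 2 : ℝ) ^ i * (1 / 7) :=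
          sum_le_sum fun i hi => estB i (not_le.1 (mem_filter.1 hi).2)
      _ ≤ ∑ i ∈ range (I + 1), (1 / 2 : ℝ) ^ i * (1 / 7) := by
          apply sum_le_sum_of_subset_of_nonneg
          · intro i hi
            have := (mem_filter.1 hi).1
            rw [hT, mem_Ico] at this
            exact mem_range.2 this.2
          · intro i _ _; positivity
      _ = (∑ i ∈ range (I + 1), (1 / 2 : ℝ) ^ i) * (1 / 7) := by rw [sum_mul]
      _ ≤ 2 * (1 / 7) := mul_le_mul_of_nonneg_right (geom_half_le _) (by norm_num)
      _ = 2 / 7 := by norm_num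
  -- representatives per block
  have hRex : ∀ j, ∃ r, (S.filter (fun i => J i = j)).Nonempty →
      r ∈ S.filter (fun i => J i = j) ∧ ∀ i' ∈ S.filter (fun i => J i = j), sh a B (W i') ≤ sh a B (W r) := by
    intro j
    by_cases hne : (S.filter (fun i => J i = j)).Nonempty
    · obtain ⟨r, hr, hmax⟩ := exists_max_image _ (fun i => sh a B (W i)) hne
      exact ⟨r, fun _ => ⟨hr, hmax⟩⟩
    · exact ⟨0, fun h' => absurd h' hne⟩
  choose R hR using hRex
  -- ρ j
  let ρ : ℕ → ℝ := fun j => if (S.filter (fun i => J i = j)).Nonempty then sh a B (W (R j)) else 0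
  have hρnn : ∀ j, 0 ≤ ρ j := fun j => by
    simp only [ρ]; split_ifs
    · exact sh_nonneg h _
    · exact le_rfl
  have hρS : ∀ i ∈ S, sh a B (W i) ≤ ρ (J i) := by
    intro i hi
    have hmem : i ∈ S.filter (fun i' => J i' = J i) := mem_filter.2 ⟨hi, rfl⟩
    have hne : (S.filter (fun i' => J i' = J i)).Nonempty := ⟨i, hmem⟩
    simp only [ρ, if_pos hne]
    exact (hR (J i) hne).2 i hmem
  -- non-escaped part ≤ 2 Σ ρ
  have hSsum : ∑ i ∈ S, sh a B (blk h hτ m₀ (i + 1) - 5) ≤ 2 * ∑ j ∈ range (I + 1), ρ j := by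
    have hS' : ∀ i ∈ S, m₀ ≤ W i := fun i hi => (mem_filter.1 hi).2
    calc ∑ i ∈ S, sh a B (blk h hτ m₀ (i + 1) - 5)
        ≤ ∑ i ∈ S, (1 / 2 : ℝ) ^ (i - J i) * ρ (J i) := by
          apply sum_le_sum
          intro i hi
          exact (estA i (hS' i hi)).2.trans
            (mul_le_mul_of_nonneg_left (hρS i hi) (by positivity))
      _ = ∑ j ∈ range (I + 1), ∑ i ∈ S.filter (fun i => J i = j), (1 / 2 : ℝ) ^ (i - J i) * ρ (J i) := by
          symm
          apply sum_fiberwise_of_maps_to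
          intro i hi
          have h1 := (estA i (hS' i hi)).1
          have h2 : i ∈ T := (mem_filter.1 hi).1
          rw [hT, mem_Ico] at h2
          exact mem_range.2 (by omega)
      _ ≤ ∑ j ∈ range (I + 1), 2 * ρ j := by
          apply sum_le_sum
          intro j _
          have hrw : ∑ i ∈ S.filter (fun i => J i = j), (1 / 2 : ℝ) ^ (i - J i) * ρ (J i) =
              (∑ i ∈ S.filter (fun i => J i = j), (1 / 2 : ℝ) ^ (i - j)) * ρ j := by
            rw [sum_mul]
            apply sum_congr rfl
            intro i hi
            rw [(mem_filter.1 hi).2]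
          rw [hrw]
          apply mul_le_mul_of_nonneg_right _ (hρnn j)
          -- the fiber lies in [j, I]
          have hsub : S.filter (fun i => J i = j) ⊆ Ico j (I + 1) := by
            intro i hi
            obtain ⟨hiS, hij⟩ := mem_filter.1 hi
            have h1 := (estA i (hS' i hiS)).1
            have h2 : i ∈ T := (mem_filter.1 hiS).1
            rw [hT, mem_Ico] at h2
            rw [mem_Ico]; omega
          calc ∑ i ∈ S.filter (fun i => J i = j), (1 / 2 : ℝ) ^ (i - j)
              ≤ ∑ i ∈ Ico j (I + 1), (1 / 2 : ℝ) ^ (i - j) :=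
                sum_le_sum_of_subset_of_nonneg hsub fun _ _ _ => by positivity
            _ = ∑ t ∈ range (I + 1 - j), (1 / 2 : ℝ) ^ t := by
                rw [sum_Ico_eq_sum_range]
                apply sum_congr rfl
                intro t _
                rw [Nat.add_sub_cancel_left]
            _ ≤ 2 := geom_half_le _
      _ = 2 * ∑ j ∈ range (I + 1), ρ j := by rw [mul_sum]
  -- hence Σ ρ ≥ 2 M
  have hρsum : (2 : ℝ) * M ≤ ∑ j ∈ range (I + 1), ρ j := by
    have hsplit := sum_filter_add_sum_filter_not T (fun i => m₀ ≤ W i)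
      (fun i => sh a B (blk h hτ m₀ (i + 1) - 5))
    -- Q ≤ Σ_Ico ≤ Cτ Σ_T = Cτ (Σ_S + Σ_E) ≤ Cτ (2 Σρ + 2/7)
    have h1 : Q ≤ Cτ * (2 * ∑ j ∈ range (I + 1), ρ j + 2 / 7) := by
      calc Q ≤ ∑ k ∈ Ico (blk h hτ m₀ 1) (blk h hτ m₀ (I + 1)), sh a B k := hIco
        _ ≤ Cτ * ∑ i ∈ T, sh a B (blk h hτ m₀ (i + 1) - 5) := hsumT
        _ = Cτ * (∑ i ∈ S, sh a B (blk h hτ m₀ (i + 1) - 5) +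
              ∑ i ∈ T.filter (fun i => ¬ m₀ ≤ W i), sh a B (blk h hτ m₀ (i + 1) - 5)) := by
            rw [hS, hsplit]
        _ ≤ Cτ * (2 * ∑ j ∈ range (I + 1), ρ j + 2 / 7) :=
            mul_le_mul_of_nonneg_left (add_le_add hSsum hE) hCτpos.le
    rw [hQ] at h1
    have := le_of_mul_le_mul_left h1 hCτpos
    linarith
  -- residue class mod 2 of the block index
  obtain ⟨r, -, hr⟩ := exists_residue_class (𝒦 := range (I + 1)) (f := ρ) (L := 2) (by norm_num)
    (by simpa using hρsum)
  -- the family: representatives of the good blocks of parity r with a nonempty fiber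
  set G := (range (I + 1)).filter (fun j => j % 2 = r ∧ (S.filter (fun i => J i = j)).Nonempty) with hG
  have hGfacts : ∀ j ∈ G, m₀ ≤ W (R j) ∧ blk h hτ m₀ j ≤ W (R j) ∧ W (R j) < blk h hτ m₀ (j + 1) ∧
      j % 2 = r ∧ ρ j = sh a B (W (R j)) := by
    intro j hj
    obtain ⟨-, hjr, hne⟩ := mem_filter.1 hj
    obtain ⟨hRmem, -⟩ := hR j hne
    obtain ⟨hRS, hRJ⟩ := mem_filter.1 hRmem
    have hm : m₀ ≤ W (R j) := (mem_filter.1 hRS).2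
    obtain ⟨hb1, hb2⟩ := hJ (R j) hm
    rw [hRJ] at hb1 hb2
    exact ⟨hm, hb1, hb2, hjr, by simp only [ρ, if_pos hne]⟩
  refine ⟨G.image (fun j => W (R j)), ?_, ?_, ?_⟩
  · -- windowed and ≥ k₀
    intro k hk
    obtain ⟨j, hj, rfl⟩ := mem_image.1 hk
    obtain ⟨hm, -, -, -, -⟩ := hGfacts j hj
    refine ⟨hm₀k.trans hm, ?_⟩
    rcases hend (R j) with hwin | hsmall
    · exact hwin
    · omega
  · -- pairwise decay separation
    intro k hk ℓ hℓ hkℓ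
    obtain ⟨j, hj, rfl⟩ := mem_image.1 hk
    obtain ⟨j', hj', rfl⟩ := mem_image.1 hℓ
    obtain ⟨-, hb1, hb2, hjr, -⟩ := hGfacts j hj
    obtain ⟨-, hb1', hb2', hjr', -⟩ := hGfacts j' hj'
    have hjj' : j < j' := by
      by_contra hle
      push Not at hle
      have := blk_le_of_le h hτ m₀ (show j' + 1 ≤ j + 1 by omega)
      rcases Nat.lt_or_ge j' j with hlt | hge
      · have := blk_le_of_le h hτ m₀ (show j' + 1 ≤ j by omega); omega
      · have : j = j' := le_antisymm (by omega) hle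
        subst this; exact absurd hkℓ (lt_irrefl _)
    have hj2 : j + 2 ≤ j' := by omega
    exact sep_of_blk h hτ m₀ hτ.le hb2 hj2 hb1'
  · -- total share
    have hinj : Set.InjOn (fun j => W (R j)) ↑G := by
      intro j hj j' hj' hjj'
      obtain ⟨-, hb1, hb2, -, -⟩ := hGfacts j hj
      obtain ⟨-, hb1', hb2', -, -⟩ := hGfacts j' hj'
      simp only at hjj'
      rw [hjj'] at hb1 hb2
      have h1 : blk h hτ m₀ j < blk h hτ m₀ (j' + 1) := by omega
      have h2 : blk h hτ m₀ j' < blk h hτ m₀ (j + 1) := by omega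
      have := (blk_strictMono h hτ m₀).lt_iff_lt.1 h1
      have := (blk_strictMono h hτ m₀).lt_iff_lt.1 h2
      omega
    rw [sum_image hinj]
    have hGsum : ∑ j ∈ G, sh a B (W (R j)) = ∑ j ∈ G, ρ j :=
      sum_congr rfl fun j hj => (hGfacts j hj).2.2.2.2.symm
    rw [hGsum, hG]
    -- Σ over parity class = Σ over G (empty fibers contribute 0)
    have hsplit := sum_filter_add_sum_filter_not ((range (I + 1)).filter (fun j => j % 2 = r))
      (fun j => (S.filter (fun i => J i = j)).Nonempty) ρ
    have hzero : ∑ j ∈ ((range (I + 1)).filter (fun j => j % 2 = r)).filter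
        (fun j => ¬ (S.filter (fun i => J i = j)).Nonempty), ρ j = 0 :=
      sum_eq_zero fun j hj => by simp only [ρ, if_neg (mem_filter.1 hj).2]
    rw [hzero, add_zero, filter_filter] at hsplit
    rw [hsplit]
    exact hr

end CaseB

/-! ### Main theorem -/

/-- **`AbstractHarvest` holds** (window constant `A = 128^16 = 2^112`; endgame over `min τ 1`;
Case A / Case B on whether shares `≥ 1/9728` occur beyond every index). -/
theorem abstractHarvest_proof : AbstractHarvest := by
  intro a B h
  refine ⟨(128 : ℝ) ^ 16, one_le_pow₀ (by norm_num), fun τ hτ k₀ M => ?_⟩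
  apply harvest_of_decayFamily h hτ k₀
  intro M'
  have hτ'0 : 0 < min τ 1 := lt_min hτ one_pos
  have hτ'1 : min τ 1 ≤ 1 := min_le_right _ _
  by_cases hA : ∀ n : ℕ, ∃ k, n ≤ k ∧ 1 / 9728 ≤ sh a B k
  · exact caseA h hτ'0 k₀ hA M'
  · push Not at hA
    obtain ⟨K, hK⟩ := hA
    exact caseB h hτ'0 hτ'1 k₀ (K := K) (fun k hk => (hK k hk).le) M'

/-- The registered stub `stub_abstractHarvest` of line `dominant-shell-concentration`, verbatim
signature, as a corollary (candidate proof; the landing is the lead prover's). -/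
theorem stub_abstractHarvest_candidate :
    ∀ a B : ℕ → ℝ, HarvestData a B →
      ∃ A : ℝ, 1 ≤ A ∧ ∀ τ : ℝ, 0 < τ → ∀ (k₀ : ℕ) (M : ℝ), ∃ 𝒦 : Finset ℕ,
        (∀ k ∈ 𝒦, k₀ ≤ k ∧ a (k - 4) ≤ A * a (k + 4)) ∧
        (∀ k ∈ 𝒦, ∀ ℓ ∈ 𝒦, k < ℓ → a (ℓ - 2) ≤ τ * a (k + 2) ∧ (2 : ℝ) ^ (k + 1) ≤ τ * 2 ^ ℓ) ∧
        M ≤ ∑ k ∈ 𝒦, (8 : ℝ) ^ k * a (k + 2) ^ 2 / B (k + 1) :=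
  abstractHarvest_proof

/- Hence `ShareHarvest` follows with the landed `stub_harvestInputs` (p73276) exactly as in the
skeleton's `shareHarvest_of` (module `…HarvestInputs` not yet built on the farm at the time of
writing, so the two-line corollary is left to the lead). -/

end HarvestCore
end Summit.CriticalPhenomena.Ising3DConformalLimit.RungOneAdjacentMergingDominantShell

end

/-! ## Part 2 — `Assembly` (drefute gen 3, AssemblyG3.lean verbatim minus its import) -/

/-!
# `Assembly` (= registered stub `stub_assembly` of line `dominant-shell-concentration`,
# crux `RungOneAdjacentMerging`, item stmt-CriticalPhenomena-11262) — candidate proof (drefute gen 3)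

Refuter work file (refuter-drefute-stmt-CriticalPhenomena-11262-g3-0).  A sorry-free proof of
`Assembly : TowardCells → WindowRegular → ShareHarvest → VarianceBound` from the lead's landed
auxiliary lemmas (`Theorems/EnergyNotSigmaSquaredRungOneAdjacentMergingAssemblyAux.lean`, p73984):
the strongest possible certificate that the stub is not misstated.  Positive statements are not the
refuter's to land: this file travels as candidate evidence for the lead prover.

Structure: `infVolWeights_of_blocks` (abstract: cell-indexed weights + block bounds ⇒ `InfVolWeights`),
`summand_le` (pointwise pair bound through the cone reduction, both systems), `block_cross_le`,
`block_diag_le`, and `assembly_proof : Assembly` (constants: `η₁ = min η 16`,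
`τ = min (1/16) (η₁/(8(C+1)))`, `M = 8/(c₀ η₁)`, `k₀ = 4`, `R = 2^(sup 𝒦 + 4)`, weights
`w_k = share k / Σ_𝒦 share`, `c(u) = Σ_k 1[u ∈ U_k] w_k/(|U_k| dens dens')`).
-/

noncomputable section

open Finset
open scoped BigOperators
open Literature.Probability.LatticeModels

namespace Summit.CriticalPhenomena.Ising3DConformalLimit.RungOneAdjacentMergingDominantShell
namespace AssemblyG3

/-- ABSTRACT ASSEMBLY: cell-indexed nonnegative weights with block means `w_k` (`Σ w = 1`) and block
second sums at most `w_k w_ℓ Q + 1[k = ℓ] D w_k`, `Q + D ≤ (1+η) G(x)²`, give `InfVolWeights η x`. -/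
theorem infVolWeights_of_blocks {x : Site 3} {η Q D : ℝ} (𝒦 : Finset ℕ) (V : ℕ → Finset (Site 3))
    (g : ℕ → Site 3 → ℝ) (w : ℕ → ℝ) (hg0 : ∀ k u, 0 ≤ g k u)
    (hmean : ∀ k ∈ 𝒦, ∑ u ∈ V k, g k u * (dens x u * dens x (u - e₂)) = w k)
    (hw1 : ∑ k ∈ 𝒦, w k = 1)
    (hblock : ∀ k ∈ 𝒦, ∀ ℓ ∈ 𝒦,
      ∑ u ∈ V k, ∑ v ∈ V ℓ, g k u * g ℓ v * (tstep x u v * tstep x (u - e₂) (v - e₂)) ≤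
        w k * w ℓ * Q + if k = ℓ then D * w k else 0)
    (hQD : Q + D ≤ (1 + η) * Gc x ^ 2) : InfVolWeights η x := by
  have hVU : ∀ k ∈ 𝒦, V k ⊆ 𝒦.biUnion V := fun k hk => Finset.subset_biUnion_of_mem V hk
  have hm : ∑ u ∈ 𝒦.biUnion V, (∑ k ∈ 𝒦, if u ∈ V k then g k u else 0) *
      (dens x u * dens x (u - e₂)) = 1 := by
    rw [asm_sum_expand _ 𝒦 V hVU g (fun u => dens x u * dens x (u - e₂)), ← hw1]
    exact Finset.sum_congr rfl hmean
  refine ⟨𝒦.biUnion V, fun u => ∑ k ∈ 𝒦, if u ∈ V k then g k u else 0, ?_, ?_, ?_⟩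
  · intro u
    exact Finset.sum_nonneg fun k _ => by
      split_ifs
      · exact hg0 k u
      · exact le_rfl
  · show 0 < ∑ u ∈ 𝒦.biUnion V, (∑ k ∈ 𝒦, if u ∈ V k then g k u else 0) *
      (dens x u * dens x (u - e₂))
    rw [hm]
    exact one_pos
  · show ∑ u ∈ 𝒦.biUnion V, ∑ v ∈ 𝒦.biUnion V, (∑ k ∈ 𝒦, if u ∈ V k then g k u else 0) *
        (∑ k ∈ 𝒦, if v ∈ V k then g k v else 0) * (tstep x u v * tstep x (u - e₂) (v - e₂)) ≤
      (1 + η) * Gc x ^ 2 * (∑ u ∈ 𝒦.biUnion V, (∑ k ∈ 𝒦, if u ∈ V k then g k u else 0) *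
        (dens x u * dens x (u - e₂))) ^ 2
    rw [hm, asm_sum_expand₂ _ 𝒦 V hVU g (fun u v => tstep x u v * tstep x (u - e₂) (v - e₂))]
    calc ∑ k ∈ 𝒦, ∑ ℓ ∈ 𝒦, ∑ u ∈ V k, ∑ v ∈ V ℓ,
          g k u * g ℓ v * (tstep x u v * tstep x (u - e₂) (v - e₂))
        ≤ ∑ k ∈ 𝒦, ∑ ℓ ∈ 𝒦, (w k * w ℓ * Q + if k = ℓ then D * w k else 0) :=
          Finset.sum_le_sum fun k hk => Finset.sum_le_sum fun ℓ hℓ => hblock k hk ℓ hℓ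
      _ = (∑ k ∈ 𝒦, w k) * (∑ k ∈ 𝒦, w k) * Q + D * ∑ k ∈ 𝒦, w k := asm_double_sum_eq 𝒦 w Q D
      _ = Q + D := by rw [hw1]; ring
      _ ≤ (1 + η) * Gc x ^ 2 := hQD
      _ = (1 + η) * Gc x ^ 2 * 1 ^ 2 := by ring

/-- POINTWISE PAIR BOUND: with weights `s/(m·dens·dens')`, `t/(n·dens·dens')` and `x` seeing
`u, u - e₂, v, v - e₂` in its toward-cone, ratio bounds `X`, `Y` for the two systems with `XY ≤ ρ`
bound the summand by `(st/(mn))·G(x)²·ρ` (cone reduction `asm_tstep_le` twice + `asm_pair_le`). -/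
theorem summand_le {x u v : Site 3} {s t m n X Y ρ : ℝ} (hm : 0 < m) (hn : 0 < n) (hs : 0 ≤ s)
    (ht : 0 ≤ t) (hxu : Gc x ≤ Gc (x - u)) (hxu' : Gc x ≤ Gc (x - (u - e₂)))
    (hxv : Gc x ≤ Gc (x - v)) (hxv' : Gc x ≤ Gc (x - (v - e₂)))
    (hX : Gc (v - u) / Gc v + Gc (u - v) / Gc u ≤ X)
    (hY : Gc (v - u) / Gc (v - e₂) + Gc (u - v) / Gc (u - e₂) ≤ Y) (hρ : X * Y ≤ ρ) :
    s / (m * (dens x u * dens x (u - e₂))) * (t / (n * (dens x v * dens x (v - e₂)))) *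
      (tstep x u v * tstep x (u - e₂) (v - e₂)) ≤ s * t / (m * n) * Gc x ^ 2 * ρ := by
  have hT := asm_tstep_le x u v hxu hxv X hX
  have hT' := asm_tstep_le x (u - e₂) (v - e₂) hxu' hxv' Y
    (by simpa only [sub_sub_sub_cancel_right] using hY)
  exact asm_pair_le (asm_dens_pos x u) (asm_dens_pos x (u - e₂)) (asm_dens_pos x v)
    (asm_dens_pos x (v - e₂)) hm hn hs ht (asm_tstep_nonneg x u v) (asm_tstep_nonneg x _ _)
    hT hT' hρ

/-- CROSS BLOCK: a uniform pointwise bound `(st/(mn))·G(x)²·ρ` sums to `st·G(x)²·ρ`. -/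
theorem block_cross_le {x : Site 3} {Vk Vl : Finset (Site 3)} {s t ρ : ℝ}
    (hmk : 0 < (Vk.card : ℝ)) (hml : 0 < (Vl.card : ℝ))
    (hpt : ∀ u ∈ Vk, ∀ v ∈ Vl,
      s / (Vk.card * (dens x u * dens x (u - e₂))) * (t / (Vl.card * (dens x v * dens x (v - e₂)))) *
        (tstep x u v * tstep x (u - e₂) (v - e₂)) ≤ s * t / (Vk.card * Vl.card) * Gc x ^ 2 * ρ) :
    ∑ u ∈ Vk, ∑ v ∈ Vl, s / (Vk.card * (dens x u * dens x (u - e₂))) *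
        (t / (Vl.card * (dens x v * dens x (v - e₂)))) * (tstep x u v * tstep x (u - e₂) (v - e₂)) ≤
      s * t * (Gc x ^ 2 * ρ) := by
  calc ∑ u ∈ Vk, ∑ v ∈ Vl, s / (Vk.card * (dens x u * dens x (u - e₂))) *
        (t / (Vl.card * (dens x v * dens x (v - e₂)))) * (tstep x u v * tstep x (u - e₂) (v - e₂))
      ≤ ∑ u ∈ Vk, ∑ v ∈ Vl, s * t / (Vk.card * Vl.card) * Gc x ^ 2 * ρ :=
        Finset.sum_le_sum fun u hu => Finset.sum_le_sum fun v hv => hpt u hu v hv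
    _ = s * t * (Gc x ^ 2 * ρ) := by
        rw [Finset.sum_const, Finset.sum_const, nsmul_eq_mul, nsmul_eq_mul]
        field_simp

/-- DIAGONAL BLOCK: inside one cell (`G(u), G(u-e₂) ≥ α`, diameter `≤ L`, cone) the block second sum is
at most `(s/m)²·G(x)²·(4/α²)·(m·B(L))` (ratio `≤ 2G(u-v)/α` per system, one bubble row per `u`). -/
theorem block_diag_le {x : Site 3} {W : Finset (Site 3)} {s α L : ℝ} (hm : 0 < (W.card : ℝ))
    (hs : 0 ≤ s) (hα : 0 < α)
    (hcone : ∀ u ∈ W, Gc x ≤ Gc (x - u) ∧ Gc x ≤ Gc (x - (u - e₂)) ∧ α ≤ Gc u ∧ α ≤ Gc (u - e₂))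
    (hdiam : ∀ u ∈ W, ∀ v ∈ W, ‖u - v‖ ≤ L) :
    ∑ u ∈ W, ∑ v ∈ W, s / (W.card * (dens x u * dens x (u - e₂))) *
        (s / (W.card * (dens x v * dens x (v - e₂)))) * (tstep x u v * tstep x (u - e₂) (v - e₂)) ≤
      s * s / (W.card * W.card) * Gc x ^ 2 * (4 / α ^ 2) * (W.card * Bub L) := by
  have hrat : ∀ {p q r : Site 3}, α ≤ Gc r → Gc (p - q) ≤ Gc (q - p) / α * Gc r := by
    intro p q r hr
    calc Gc (p - q) = Gc (q - p) / α * α := by rw [asm_Gc_sub_comm p q, div_mul_cancel₀ _ hα.ne']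
      _ ≤ Gc (q - p) / α * Gc r :=
          mul_le_mul_of_nonneg_left hr (div_nonneg (asm_Gc_pos _).le hα.le)
  have hrat' : ∀ {p q r : Site 3}, α ≤ Gc r → Gc (p - q) ≤ Gc (p - q) / α * Gc r := by
    intro p q r hr
    calc Gc (p - q) = Gc (p - q) / α * α := by rw [div_mul_cancel₀ _ hα.ne']
      _ ≤ Gc (p - q) / α * Gc r :=
          mul_le_mul_of_nonneg_left hr (div_nonneg (asm_Gc_pos _).le hα.le)
  have hpt : ∀ u ∈ W, ∀ v ∈ W,
      s / (W.card * (dens x u * dens x (u - e₂))) * (s / (W.card * (dens x v * dens x (v - e₂)))) *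
          (tstep x u v * tstep x (u - e₂) (v - e₂)) ≤
        s * s / (W.card * W.card) * Gc x ^ 2 * (4 / α ^ 2 * Gc (u - v) ^ 2) := by
    intro u hu v hv
    obtain ⟨hxu, hxu', hau, hau'⟩ := hcone u hu
    obtain ⟨hxv, hxv', hav, hav'⟩ := hcone v hv
    have hX : Gc (v - u) / Gc v + Gc (u - v) / Gc u ≤ Gc (u - v) / α + Gc (u - v) / α :=
      asm_ratio_add_le (asm_Gc_pos v) (asm_Gc_pos u) (hrat hav) (hrat' hau)
    have hY : Gc (v - u) / Gc (v - e₂) + Gc (u - v) / Gc (u - e₂) ≤ Gc (u - v) / α + Gc (u - v) / α :=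
      asm_ratio_add_le (asm_Gc_pos _) (asm_Gc_pos _) (hrat hav') (hrat' hau')
    exact summand_le hm hm hs hs hxu hxu' hxv hxv' hX hY (le_of_eq (by ring))
  have hrow : ∀ u ∈ W, ∑ v ∈ W, Gc (u - v) ^ 2 ≤ Bub L := fun u hu =>
    asm_sum_sq_le_Bub u W fun v hv => hdiam u hu v hv
  have hnn : 0 ≤ s * s / (W.card * W.card) * Gc x ^ 2 * (4 / α ^ 2) := by positivity
  calc ∑ u ∈ W, ∑ v ∈ W, s / (W.card * (dens x u * dens x (u - e₂))) *
        (s / (W.card * (dens x v * dens x (v - e₂)))) * (tstep x u v * tstep x (u - e₂) (v - e₂))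
      ≤ ∑ u ∈ W, ∑ v ∈ W, s * s / (W.card * W.card) * Gc x ^ 2 * (4 / α ^ 2 * Gc (u - v) ^ 2) :=
        Finset.sum_le_sum fun u hu => Finset.sum_le_sum fun v hv => hpt u hu v hv
    _ = s * s / (W.card * W.card) * Gc x ^ 2 * (4 / α ^ 2) * ∑ u ∈ W, ∑ v ∈ W, Gc (u - v) ^ 2 := by
        rw [Finset.mul_sum]
        refine Finset.sum_congr rfl fun u _ => ?_
        rw [Finset.mul_sum]
        exact Finset.sum_congr rfl fun v _ => by ring
    _ ≤ s * s / (W.card * W.card) * Gc x ^ 2 * (4 / α ^ 2) * (W.card * Bub L) := by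
        refine mul_le_mul_of_nonneg_left ?_ hnn
        calc ∑ u ∈ W, ∑ v ∈ W, Gc (u - v) ^ 2 ≤ ∑ u ∈ W, Bub L := Finset.sum_le_sum hrow
          _ = W.card * Bub L := by rw [Finset.sum_const, nsmul_eq_mul]

/-- **`Assembly` (candidate proof of the registered stub `stub_assembly`).** -/
theorem assembly_proof : Assembly := by
  intro hcells hwin hharv η hη
  obtain ⟨c₀, hc₀, hcell⟩ := hcells
  obtain ⟨A, hA1, hH⟩ := hharv
  obtain ⟨C, hC0, hW⟩ := hwin A hA1
  -- constants
  set η₁ : ℝ := min η 16 with hη₁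
  have hη₁0 : 0 < η₁ := lt_min hη (by norm_num)
  have hη₁16 : η₁ ≤ 16 := min_le_right _ _
  have hη₁η : η₁ ≤ η := min_le_left _ _
  have hC1 : 0 < C + 1 := by linarith
  set τ : ℝ := min (1 / 16) (η₁ / (8 * (C + 1))) with hτ
  have hτ0 : 0 < τ := lt_min (by norm_num) (div_pos hη₁0 (by positivity))
  have hτ16 : τ ≤ 1 / 16 := min_le_left _ _
  have ht0 : 0 ≤ (C + 1) * τ := by positivity
  have ht : (C + 1) * τ ≤ η₁ / 8 := by
    have h1 : τ ≤ η₁ / (8 * (C + 1)) := min_le_right _ _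
    rw [le_div_iff₀ (by positivity)] at h1
    linarith
  have hρ : (1 + (C + 1) * τ) * (1 + (C + 1) * τ) ≤ 1 + η₁ / 2 := asm_sq_le ht0 ht hη₁16
  set M : ℝ := 8 / (c₀ * η₁) with hM
  have hM0 : 0 < M := div_pos (by norm_num) (mul_pos hc₀ hη₁0)
  obtain ⟨𝒦, hKw, hKsep, hKM⟩ := hH τ hτ0 4 M
  set S : ℝ := ∑ k ∈ 𝒦, share k with hS
  have hS0 : 0 < S := hM0.trans_le hKM
  have h8 : 8 ≤ c₀ * η₁ * S := by
    have h1 : M ≤ S := hKM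
    rw [hM, div_le_iff₀ (mul_pos hc₀ hη₁0)] at h1
    linarith
  -- radius and far point
  refine ⟨(2 : ℝ) ^ (𝒦.sup id + 4), fun x hx => asm_infVolWeights_mono hη₁η ?_⟩
  have hxk : ∀ k ∈ 𝒦, (2 : ℝ) ^ (k + 4) ≤ ‖x‖ := fun k hk =>
    (pow_le_pow_right₀ (by norm_num) (by
      have := Finset.le_sup (f := id) hk
      simp only [id_eq] at this
      omega)).trans hx
  -- cells
  have hex : ∀ k, ∃ U : Finset (Site 3), k ∈ 𝒦 →
      (c₀ * 8 ^ k ≤ (U.card : ℝ) ∧ ∀ u ∈ U,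
        (2 : ℝ) ^ (k - 1) ≤ ‖u‖ ∧ ‖u‖ ≤ (2 : ℝ) ^ k ∧
        Gc x ≤ Gc (x - u) ∧ Gc x ≤ Gc (x - (u - e₂)) ∧
        axisG (2 ^ (k + 2)) ≤ Gc u ∧ axisG (2 ^ (k + 2)) ≤ Gc (u - e₂)) := by
    intro k
    by_cases hk : k ∈ 𝒦
    · obtain ⟨U, hU⟩ := hcell k (hKw k hk).1 x (hxk k hk)
      exact ⟨U, fun _ => hU⟩
    · exact ⟨∅, fun h => (hk h).elim⟩
  choose V hV using hex
  have hm : ∀ k ∈ 𝒦, 0 < ((V k).card : ℝ) := fun k hk =>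
    lt_of_lt_of_le (by positivity) (hV k hk).1
  have hw0 : ∀ k, 0 ≤ share k / S := fun k => div_nonneg (share_nonneg k) hS0.le
  -- the abstract assembly with share-proportional weights
  refine infVolWeights_of_blocks (Q := Gc x ^ 2 * (1 + η₁ / 2)) (D := 4 / (c₀ * S) * Gc x ^ 2) 𝒦 V
    (fun k u => share k / S / ((V k).card * (dens x u * dens x (u - e₂)))) (fun k => share k / S)
    ?_ ?_ ?_ ?_ ?_
  · -- nonnegativity
    intro k u
    exact div_nonneg (hw0 k) (mul_nonneg (Nat.cast_nonneg _)
      (mul_nonneg (asm_dens_pos x u).le (asm_dens_pos x _).le))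
  · -- block means
    intro k hk
    have hterm : ∀ u ∈ V k, share k / S / ((V k).card * (dens x u * dens x (u - e₂))) *
        (dens x u * dens x (u - e₂)) = share k / S / (V k).card := by
      intro u _
      have hd : dens x u * dens x (u - e₂) ≠ 0 :=
        (mul_pos (asm_dens_pos x u) (asm_dens_pos x _)).ne'
      rw [div_mul_eq_mul_div, mul_div_mul_right _ _ hd]
    rw [Finset.sum_congr rfl hterm, Finset.sum_const, nsmul_eq_mul, mul_div_cancel₀ _ (hm k hk).ne']
  · -- total weight one
    rw [← Finset.sum_div, div_self hS0.ne']
  · -- block bounds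
    intro k hk ℓ hℓ
    obtain ⟨hcardk, huk⟩ := hV k hk
    obtain ⟨hcardl, hvl⟩ := hV ℓ hℓ
    rcases lt_trichotomy k ℓ with hkl | rfl | hlk
    · -- cross, k < ℓ : u small, v large
      rw [if_neg hkl.ne, add_zero]
      refine block_cross_le (hm k hk) (hm ℓ hℓ) fun u hu v hv => ?_
      obtain ⟨-, hu2, hxu, hxu', hau, hau'⟩ := huk u hu
      obtain ⟨hv1, hv2, hxv, hxv', -, -⟩ := hvl v hv
      have hc := asm_cross hC0 hτ0.le hτ16 hW (hKw ℓ hℓ).1 (hKw ℓ hℓ).2 (hKsep k hk ℓ hℓ hkl).1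
        (hKsep k hk ℓ hℓ hkl).2 hu2 hv1 hv2 hau hau'
      have e : 1 + C * τ + τ = 1 + (C + 1) * τ := by ring
      have hX : Gc (v - u) / Gc v + Gc (u - v) / Gc u ≤ 1 + (C + 1) * τ :=
        (asm_ratio_add_le (asm_Gc_pos v) (asm_Gc_pos u) hc.1 hc.2.2.1).trans_eq e
      have hY : Gc (v - u) / Gc (v - e₂) + Gc (u - v) / Gc (u - e₂) ≤ 1 + (C + 1) * τ :=
        (asm_ratio_add_le (asm_Gc_pos _) (asm_Gc_pos _) hc.2.1 hc.2.2.2).trans_eq e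
      exact summand_le (hm k hk) (hm ℓ hℓ) (hw0 k) (hw0 ℓ) hxu hxu' hxv hxv' hX hY hρ
    · -- diagonal
      rw [if_pos rfl]
      have hdiam : ∀ u ∈ V k, ∀ v ∈ V k, ‖u - v‖ ≤ (2 : ℝ) ^ (k + 1) := by
        intro u hu v hv
        have h1 := (huk u hu).2.1
        have h2 := (huk v hv).2.1
        have h3 := norm_sub_le u v
        rw [pow_succ]
        linarith
      have hd := block_diag_le (L := (2 : ℝ) ^ (k + 1)) (hm k hk) (hw0 k) (asm_axisG_pos (2 ^ (k + 2)))
        (fun u hu => ⟨(huk u hu).2.2.1, (huk u hu).2.2.2.1, (huk u hu).2.2.2.2.1,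
          (huk u hu).2.2.2.2.2⟩) hdiam
      have hE : c₀ * S * (8 ^ k / S) ≤ (V k).card := by
        have : c₀ * S * (8 ^ k / S) = c₀ * 8 ^ k := by field_simp
        rw [this]
        exact hcardk
      have hsh : share k / S = 8 ^ k / S * axisG (2 ^ (k + 2)) ^ 2 / Bub (2 ^ (k + 1)) := by
        rw [share]
        ring
      have hdc := asm_diag_const (G := Gc x) hsh (asm_Bub_pos (by positivity)) (asm_axisG_pos _)
        (hm k hk) (mul_pos hc₀ hS0) (by positivity) hE
      have hnn : 0 ≤ share k / S * (share k / S) * (Gc x ^ 2 * (1 + η₁ / 2)) :=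
        mul_nonneg (mul_nonneg (hw0 k) (hw0 k)) (by positivity)
      linarith [hd.trans hdc]
    · -- cross, ℓ < k : u large, v small
      rw [if_neg hlk.ne', add_zero]
      refine block_cross_le (hm k hk) (hm ℓ hℓ) fun u hu v hv => ?_
      obtain ⟨hu1, hu2, hxu, hxu', hau, hau'⟩ := huk u hu
      obtain ⟨-, hv2, hxv, hxv', hav, hav'⟩ := hvl v hv
      have hc := asm_cross hC0 hτ0.le hτ16 hW (hKw k hk).1 (hKw k hk).2 (hKsep ℓ hℓ k hk hlk).1
        (hKsep ℓ hℓ k hk hlk).2 hv2 hu1 hu2 hav hav'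
      have e : τ + (1 + C * τ) = 1 + (C + 1) * τ := by ring
      have hX : Gc (v - u) / Gc v + Gc (u - v) / Gc u ≤ 1 + (C + 1) * τ :=
        (asm_ratio_add_le (asm_Gc_pos v) (asm_Gc_pos u) hc.2.2.1 hc.1).trans_eq e
      have hY : Gc (v - u) / Gc (v - e₂) + Gc (u - v) / Gc (u - e₂) ≤ 1 + (C + 1) * τ :=
        (asm_ratio_add_le (asm_Gc_pos _) (asm_Gc_pos _) hc.2.2.2 hc.2.1).trans_eq e
      exact summand_le (hm k hk) (hm ℓ hℓ) (hw0 k) (hw0 ℓ) hxu hxu' hxv hxv' hX hY hρ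
  · -- Q + D ≤ (1 + η₁) G(x)²
    have h4 : 4 / (c₀ * S) ≤ η₁ / 2 := by
      rw [div_le_div_iff₀ (mul_pos hc₀ hS0) (by norm_num : (0 : ℝ) < 2)]
      nlinarith
    have hG2 : 0 ≤ Gc x ^ 2 := sq_nonneg _
    calc Gc x ^ 2 * (1 + η₁ / 2) + 4 / (c₀ * S) * Gc x ^ 2
        = Gc x ^ 2 * (1 + η₁ / 2 + 4 / (c₀ * S)) := by ring
      _ ≤ Gc x ^ 2 * (1 + η₁) := mul_le_mul_of_nonneg_left (by linarith) hG2
      _ = (1 + η₁) * Gc x ^ 2 := by ring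

/-- The registered stub signature, verbatim. -/
theorem stub_assembly_candidate : TowardCells → WindowRegular → ShareHarvest →
    ∀ η : ℝ, 0 < η → ∃ R : ℝ, ∀ x : Site 3, R ≤ ‖x‖ → InfVolWeights η x :=
  assembly_proof

end AssemblyG3
end Summit.CriticalPhenomena.Ising3DConformalLimit.RungOneAdjacentMergingDominantShell

end

/-! ## Part 3 — composition: the crux from the landed stubs and parts 1–2 (kernel-checked, no sorry) -/

noncomputable section

open Literature.Probability.LatticeModels

namespace Summit.CriticalPhenomena.Ising3DConformalLimit.RungOneAdjacentMergingDominantShell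
namespace CruxCandidateG3

/-- `ShareHarvest` from the landed harvest inputs and the proved abstract harvest (unfolding). -/
theorem shareHarvest_holds : ShareHarvest := by
  obtain ⟨A, hA1, h⟩ := HarvestCore.abstractHarvest_proof _ _ stub_harvestInputs
  refine ⟨A, hA1, fun τ hτ k₀ M => ?_⟩
  obtain ⟨𝒦, hw, hsep, hM⟩ := h τ hτ k₀ M
  refine ⟨𝒦, fun k hk => ⟨(hw k hk).1, ?_⟩, fun k hk ℓ hℓ hkℓ => hsep k hk ℓ hℓ hkℓ, ?_⟩
  · simpa [HasWindow] using (hw k hk).2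
  · simpa [share] using hM

/-- The infinite-volume variance bound (STUB 6 fed with STUBS 3, 4 and the harvest). -/
theorem varianceBound_holds : VarianceBound :=
  AssemblyG3.assembly_proof stub_cells stub_windowRegular shareHarvest_holds

/-- **The crux**: `RungOneAdjacentMerging` (route `EnergyNotSigmaSquared`, rank 5), sorry-free. -/
theorem rungOneAdjacentMerging_candidate :
    Summit.CriticalPhenomena.Ising3DConformalLimit.Theses.EnergyNotSigmaSquared.RungOneAdjacentMerging := by
  intro ε hε
  obtain ⟨R, hR⟩ := varianceBound_holds (ε / 2) (half_pos hε)
  refine ⟨R, fun x hx => ?_⟩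
  obtain ⟨n₀, hn₀⟩ := stub_boxPassage x (ε / 2) ε (half_pos hε) (half_lt_self hε) (hR x hx)
  refine ⟨n₀, fun n hn o a y y' ho ha hy hy' => ?_⟩
  exact stub_chebyshev (↥(box 3 n)) ((zdGraph 3).comap (Subtype.val : ↥(box 3 n) → Site 3))
    (criticalBeta 3) (criticalBeta_nonneg 3) ε hε.le o a y y' (hn₀ n hn o a y y' ho ha hy hy')

end CruxCandidateG3
end Summit.CriticalPhenomena.Ising3DConformalLimit.RungOneAdjacentMergingDominantShell

end
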